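/-
Copyright: lit-balaban cell, Phase-2 proof seat p33 (gen 12).  Statement-level skeleton of a published paper; no proof claims beyond
what the kernel checks below.
-/
import Literature.MathematicalPhysics.QuantumFieldTheory.BalabanImbrieJaffe1984to88.BIJ85RegionPropagatorsActualBgMembers
import Literature.MathematicalPhysics.QuantumFieldTheory.Balaban1983to89.B4ThmRegionPairEta

/-!
# `BalabanImbrieJaffe1984to88.BIJ85RegionPropagatorsActualBgThm` — T. Bałaban, J. Imbrie, A. Jaffe, *Renormalization of the Higgs
model: minimizers, propagators and the stability of mean field theory*, Commun. Math. Phys. **97** (1985) 299–329 [BalabanImbrieJaffe1985],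
Sect. 7.3 p. 326 [PDF 28], with [7] = T. Bałaban, *Regularity and decay of lattice Green's functions*, Commun. Math. Phys. **89** (1983)
571–597 [Balaban1983RegularityDecay], THEOREM p. 573 (1.9)–(1.12) and (1.8): **THE TYPED THEOREM OF [7] (b04/pv17's `ThmPrintedNN`) AND
THE TYPED (1.8) (`Claim18Printed`) HOLD FOR THE FAMILY OF [7]-INSTANCES ARISING FROM THE ACTUAL BACKGROUND `u_k` UNDER (7.3.1)** — file 6
after `BIJ85RegionPropagatorsActualBg` (file 4) and `BIJ85RegionPropagatorsActualBgMembers` (file 5).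

statement-level skeleton of published theorems with citation tags; proofs where landed; nothing here is a claim about the Yang–Mills mass gap

PDFs held: `paper:balaban1985-cmp97-bij-higgs-minimizers` (journal page = PDF page + 298), p. 326 [PDF 28]; `paper:balaban1983-cmp89-regularity-decay`
(journal page = PDF page + 570), pp. 572–573.  Both re-read this generation (text layer).

CITATION HEADER (lean-in-tree rule).  Phase-2 file of the lit-balaban TYPED SKELETON (HOME `run/shared/lean/pub/lit-balaban/`), seat p33
gen 12 (unit `lit-balaban-p33-g12`); SKELETON row **C1.Eq7.3.1-7.3.2** (owner r15, referee ref-5) × **B4.Thm@573** / **B4.Claim@573(1.8)**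
(owner r01: `B4ThmRegionPairEta.thmPrintedNN_regionPairFam`, `claim18Printed_regionPairFam`, `region_pair_members` CONSUMED BY NAME);
HOME/GAPS.md G-C1-05 ADDENDUM 12.  THE PRINTED TEXTS, verbatim.  [BalabanImbrieJaffe1985] p. 326: *"The propagators arising from Δ_k(u_k),
under the restriction (7.3.1) on the gauge field, also satisfy the regularity and decay estimates of [7]. In order to remain within the
framework of this reference, we remark that by change of gauge u_k can be transformed in a local region Λ into a configuration of the form
exp[ie_kηA], where A is smooth and small."*  [7] p. 573: *"Theorem (Proposition 2.1 of [1]). For α < 1 there exist positive constants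
δ₀, c₀, R₀ independent of A, k, Ω and depending on d, M only, c₀ on α also, such that for e sufficiently small and for an arbitrary function
f : Ω → R^N, we have [(1.9)] for x, x′ ∈ Ω, and satisfying the condition dist({x, x′}, Ω^c) ≥ R₀. Similarly [(1.10)] for x ∈ Ω,
dist(x, Ω^c) ≥ R₀. If Ω ⊂ Ω₀, then for δG_k(Ω, Ω₀, A) … (1.11) we have the inequalities … with the additional factor [(1.12)]"*; p. 573:
*"there exists a positive constant γ₀ such that for e sufficiently small and for a regular vector field A, −Δ^{η,N}_{A,Ω} + aP_k(A) ≥ γ₀I.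
(1.8) The constant γ₀ is independent of the lattice spacing η, as well as of Ω and of A."*

THE POINT OF THIS FILE.  b04 typed [7]'s Theorem as a statement `B4.ThmPrinted fam` about a FAMILY `fam : I → B4.EtaSetting` of instances
(pv17's `ThmPrintedNN` = its `0 ≤ α` restriction, referee ruling G-ref1-32), and (1.8) as `B4.Claim18Printed fam`; r01 inhabited both on
the family `regionPairFam` of general pairs `Ω ⊂ Ω₀` of finite unions of big blocks at a (1.7)-regular field (`B4ThmRegionPairEta`).  The
p. 326 sentence of [BalabanImbrieJaffe1985] says that the same estimates hold for the operators «arising from Δ_k(u_k), under the restriction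
(7.3.1)».  Files 4–5 transferred r01's members one by one to [7]'s region operators fed with the bond variables of the actual background
`u_k` (every logarithm field, regions inside a local box).  This file states the transfer IN THE TYPED CURRENCY OF ROW B4.Thm@573: the
family `actualBgFam` of `EtaSetting`s whose instances are the actual Sect. 7.3 data — a torus (`P.d = d + 1`, `P.L = ℓ + 1`), a scale
`1 ≤ k ≤ m + K`, a coupling `e`, a unit `U(1)` field `v`, a non-wrapping box, a pair `Ω ⊆ Ω₀` of finite sets of unit labels whose blocks sit
in the box, the windows `a ∈ [a₋, a₊]`, `0 ≤ m² ≤ m₊²`, and a logarithm field `A′` of `u_k = u_k(e, v)` on `Ω₀` — with EXACTLY r01's printed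
objects (`regionPairFam`'s distances, norms, Hölder quotients, `G_k(Ω, ·)`, `D^η`, `δG_k`, `lower18`) evaluated at the field `A′`, i.e. at the
bond variables of `u_k` (file 4: independent of the logarithm chosen), and with the HYPOTHESIS SLOT `regular` := (7.3.1) for `v` at `e`
(«under the restriction (7.3.1) on the gauge field») in place of (1.7) (which `A′` does not satisfy).  THEN `ThmPrintedNN (actualBgFam …)`
and `Claim18Printed (actualBgFam … K)` (every `K`) HOLD — hypothesis-free, all tori, all scales.

WHAT IS PROVED (0 `sorry`, standard axioms; 7 theorems, two plumbing definitions `ActualBgInst`, `actualBgFam` and the block size `KmodBg`;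
no named fact).
* §1 **`region_pair_members_actualBg`** — r01's `region_pair_members` (THE SIX MEMBERS (1.10) value/derivative, (1.9) all pairs, δG value/
  derivative/Hölder, packaged with ONE block size `K` chosen before `α`, ONE radius `K(d+4)`, per `α` ONE constant and ONE rate) TRANSFERRED
  VERBATIM to [7]'s operators at the actual background: same statement with the field replaced by any logarithm field `A′` of `u_k` on
  `Ω₀` and the (1.7) hypothesis replaced by (7.3.1) + the box data (conjugation by the sitewise gauge of files 1–5; constant `×4`).
* §2 `ActualBgInst` (an instance = r01's `RegionPairInst` EXTENDED by the torus/scale/field/box/logarithm data), **`actualBgFam`**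
  (r01's `regionPairFam … K` at the instance, `regular` := (7.3.1)), `actualBgFam_eq`, `KmodBg` (the block size of §1), `KmodBg_ge`,
  `hypotheses_met_actualBg` (NON-VACUITY of `regular ∧ bigBlocks ∧ 0 < e ≤ e₁` for every `K ≥ 1`, `e₁ > 0`, box size
  `n ≥ (K+1)(ℓ+1)`: the torus `(d+1, ℓ+1, m := n, K := 0)`, `k = 1`, the trivial field `v = 1`, one `K`-cube, the principal logarithm).
* §3 **`thmPrintedNN_actualBgFam : ThmPrintedNN (actualBgFam … KmodBg)`** — r01's `thmPrintedNN_regionPairFam` proof replayed verbatim on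
  the members of §1 (`δ₀ = (4K)⁻¹`, `R₀ = K(d+4) + 2`).
* §4 **`claim18Printed_actualBgFam : Claim18Printed (actualBgFam … K)`** for every `K` (`γ₀ = min(2, ¾a₋)/4`): r01's
  `claim18Printed_regionPairFam` argument (`lower18_regular_region_printed` at the running coefficient) at the smooth gauge, conjugated
  (`dotProduct_conj_mulVec` + r01's `gauge_transpose_dotProduct_self`).
HONEST SCOPE.  (i) As files 4–5: [7]'s REGION operators (Neumann bonds of `Ω`, r01's corner-based staircase block averages, running
coefficient `a_k = B1.aSeq a L k`, mass window) fed with `u_k`'s bond variables on regions inside a non-wrapping box — the reading of «the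
propagators arising from Δ_k(u_k)» as [7]'s family `G_k(Ω, ·)` at `u_k`; the relation to [BalabanImbrieJaffe1985]'s whole-torus `G_k(u_k)`
of (4.6.2) (p11's `opT`) and to the tree's centred block conventions is NOT addressed.  (ii) r01's scope notes apply verbatim (abelian flow =
`U(1)` read as `SO(2)`, `N = 2`; `ℓ^∞` distances in unit-lattice units; `cdist` = distance to ALL fine points outside `Ω`; `rect := False`;
`0 ≤ α < 1`; `L = ℓ + 1` odd `> 1` as the tori of record).  (iii) `e₁` depends on `(d, ℓ, p, n, a₋, a₊, m₊², α)`; the (1.7) constants of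
the smooth gauge are fixed inside the proofs (`c = 2`, `β = ½`).  (iv) Nothing printed is contradicted; no statement weakened; heads unchanged.
Unit `lit-balaban-p33` (literature-prover-lit-balaban-p33-g12-0), 2026-08-22.  NOT summit progress.
-/

open scoped BigOperators

namespace Literature.MathematicalPhysics.QuantumFieldTheory.BalabanImbrieJaffe1984to88.BIJ85RegionPropagatorsActualBgThm

open Balaban1983to89 hiding Site Plaq
open Balaban1983to89.LatticeFieldCalculus
open Balaban1983to89.T4AxialGaugeSmallField (castSite boxBonds)
open BIJ85Sect1Model (U1Field plaq)
open BIJ85Eq454PlaqResidual (actualBg)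
open BIJ85RegionPropagatorsActualBg (regionOp_gauge logField_arg)
open BIJ85RegionPropagatorsActualBgMembers (abs_blockDiag_mulVec_apply_le abs_gauge_mulVec_le blockDiagT_mulVec_apply
  norm_blockDiagT_mulVec_le conj_deriv_green_mulVec holderExpr_conj regionDeriv_gauge transport_acBond_gauge exists_smooth_gauge_links
  gauge_pair_apply gauge_holderPair)
open Balaban1983to89.B4 (EtaSetting Ineq19_110 Ineq111_112 Claim18Printed)
open Balaban1983to89.B4Ineq111ZeroNestEta (ThmPrintedNN)
open Balaban1983to89.B4ThmRegionPairEta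
open Balaban1983to89.B4GaugeCovariance
open Balaban1983to89.B4Lower18 (fineDom mem_fineDom IsBlockUnion fineDom_isBlockUnion)
open Balaban1983to89.B4Lower18Regular (e1 PathRel rot_lipschitz dotProduct_self_nonneg' base_le_of_blk
  gauge_transpose_dotProduct_self)
open Balaban1983to89.B4Lower18RegularRegion (compField transport_congr)
open Balaban1983to89.B4Reflection242 (nbrs mem_nbrs blk)
open Balaban1983to89.B4Lemma21Region (regionOp regionDeriv covDeriv dirKer siteNorm)
open Balaban1983to89.B4Lemma22Reduce231 (supN le_supN supN_nonneg siteNorm_nonneg siteNorm_zero siteNorm_smul)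
open Balaban1983to89.B4WalkRouteRegion (rpos)
open Balaban1983to89.B4RegionCubeCarrier (incl inReg)
open Balaban1983to89.B4ContourShift (supNorm supNorm_nonneg)
open Balaban1983to89.B4Lemma22HolderBox (IsNNChain)
open Balaban1983to89.B4Eq221L2FactorRegion (acBond)
open Balaban1983to89.B4Thm112BoxValue (siteNorm_le_sqrt_card_mul abs_apply_le_siteNorm')
open scoped Matrix
open Balaban1983to89 renaming Site → TSite, Plaq → TPlaq

noncomputable section

/-! ## §1  r01's six packaged members, transferred to [7]'s operators at the actual background -/

section Members

variable {d : ℕ}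

/-- **THE SIX MEMBERS OF [7]'s THEOREM p. 573 ON A PAIR `Ω ⊂ Ω₀`, ARBITRARY SOURCE, PACKAGED (r01's `region_pair_members`: ONE block size
`K` before `α`, ONE radius `K(d+4)`, per `α` ONE constant and the rate `e^{−·/(4nK)}`), FOR [7]'s OPERATORS AT THE ACTUAL BACKGROUND `u_k`**:
on every torus (`P.d = d + 1`, `P.L = ℓ + 1`), every scale `1 ≤ k ≤ m + K`, every `0 < e ≤ e₁`, every unit field `v` with (7.3.1), every
non-wrapping box, every pair `Ω ⊆ Ω₀` of finite unions of `K`-blocks of unit labels whose blocks sit in the box, and EVERY logarithm field `A′`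
of `u_k` on `Ω₀` (`e^{i(e/(ℓ+1)^k)A′_ν(x)} = u_k(⟨x, x + e_ν⟩)`): (1.10) value and derivative and (1.9) (all pairs, transporter `U(u_k(Γ))`) for
`G_k(Ω, u_k) = (regionOp rot e Ω A′)⁻¹`, `D^η_{u_k,μ} = regionDeriv rot e Ω A′ μ`, and the three `δG_k(Ω, Ω₀, u_k)` members with the factor
(1.12) — r01's statement verbatim with the field `A′` and the hypothesis (7.3.1) in place of (1.7).  Mechanism: files 4–5 (every logarithm
field of `u_k` is a sitewise gauge transform of the smooth small gauge of p. 326, which IS (1.7)-regular; [7] p. 580 «Using the same gauge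
transformation … we reduce them to the case A₀ = 0»); constant `4C`.
[cite: BalabanImbrieJaffe1985, §7.3 p.326; Balaban1983RegularityDecay, Theorem (1.9)–(1.12) p.573, p.580] -/
theorem region_pair_members_actualBg {d ℓ : ℕ} (hd : 1 ≤ d) (hℓ : 1 ≤ ℓ) (hodd : Odd (ℓ + 1)) (pexp : ℝ) (n : ℕ)
    (amin aplus m2plus : ℝ) (ha : 0 < amin) :
    ∃ K : ℕ, 16 ≤ K ∧ ∀ (α : ℝ), 0 ≤ α → α < 1 → ∃ C : ℝ, 0 < C ∧ ∀ (c β : ℝ), 0 < c → 0 < β → β < 1 →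
      ∃ e₁ : ℝ, 0 < e₁ ∧ ∀ (P : Params) (hPd : P.d = d + 1), P.L = ℓ + 1 → ∀ (k : ℕ), 1 ≤ k → ∀ (hk : k ≤ P.m + P.K)
      (e₀ : ℝ), 0 < e₀ → e₀ ≤ e₁ →
      ∀ (v : U1Field P k), (∀ p : TPlaq P k, ‖((plaq v p : Circle) : ℂ) - 1‖ ≤ e₀ * (1 + Real.log e₀⁻¹) ^ pexp) →
      ∀ (lo hi : Fin P.d → ℤ), (∀ κ, hi κ ≤ lo κ + n) → n < P.sitesPerDir 0 →
      ∀ (hn : 1 ≤ (ℓ + 1) ^ k) (a m2 : ℝ), amin ≤ a → a ≤ aplus → 0 ≤ m2 → m2 ≤ m2plus →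
      ∀ (Ω₀c Ωc : Finset (Fin (d + 1) → ℤ)), IsBlockUnion K Ω₀c → IsBlockUnion K Ωc → ∀ (hsub : Ωc ⊆ Ω₀c),
        (∀ y ∈ Ω₀c, ∀ i : Fin (d + 1),
          lo (Fin.cast hPd.symm i) ≤ (P.L : ℤ) ^ k * y i ∧ (P.L : ℤ) ^ k * y i + (P.L : ℤ) ^ k ≤ hi (Fin.cast hPd.symm i)) →
      ∀ (Ac' : (Fin (d + 1) → ℤ) → Fin (d + 1) → ℝ),
        (∀ x ∈ fineDom ((ℓ + 1) ^ k) Ω₀c, ∀ ν : Fin (d + 1), x + e1 ν ∈ fineDom ((ℓ + 1) ^ k) Ω₀c →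
          Circle.exp (e₀ / (((ℓ + 1) ^ k : ℕ) : ℝ) * Ac' x ν) =
            actualBg ((Nat.succ_le_succ hd).trans_eq hPd.symm) k e₀ v
              ⟨castSite (fun j : Fin P.d => x (Fin.cast hPd j)), Fin.cast hPd.symm ν⟩) →
      -- (1.10), value, on `Ω`
      (∀ (x : ↥(fineDom ((ℓ + 1) ^ k) Ωc)),
        (∀ y : Fin (d + 1) → ℤ, (∀ ν, |y ν - blk ((ℓ + 1) ^ k) x.1 ν| ≤ (K : ℤ) * (d + 4)) → y ∈ Ωc) →
        ∀ (S : ↥(fineDom ((ℓ + 1) ^ k) Ωc) → Prop) (D : ℝ), 0 ≤ D →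
        (∀ x', S x' → ∃ ν, D ≤ |rpos ((ℓ + 1) ^ k) Ωc x ν - rpos ((ℓ + 1) ^ k) Ωc x' ν|) →
        ∀ (f : ↥(fineDom ((ℓ + 1) ^ k) Ωc) × Fin 2 → ℝ), (∀ p, ¬ S p.1 → f p = 0) → ∀ i : Fin 2,
        |((regionOp OrthFlow.rot e₀ hn (B1.aSeq a ((ℓ : ℝ) + 1) k) m2 Ωc Ac')⁻¹ *ᵥ f) (x, i)|
          ≤ C * Real.exp (-(D / (4 * ((((ℓ + 1) ^ k : ℕ) : ℝ) * K)))) * ‖f‖) ∧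
      -- (1.10), derivative, on `Ω`
      (∀ (μ : Fin (d + 1)) (x : ↥(fineDom ((ℓ + 1) ^ k) Ωc)), x.1 + e1 μ ∈ fineDom ((ℓ + 1) ^ k) Ωc →
        (∀ y : Fin (d + 1) → ℤ, (∀ ν, |y ν - blk ((ℓ + 1) ^ k) x.1 ν| ≤ (K : ℤ) * (d + 4)) → y ∈ Ωc) →
        ∀ (S : ↥(fineDom ((ℓ + 1) ^ k) Ωc) → Prop) (D : ℝ), 0 ≤ D →
        (∀ x', S x' → ∃ ν, D ≤ |rpos ((ℓ + 1) ^ k) Ωc x ν - rpos ((ℓ + 1) ^ k) Ωc x' ν|) →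
        ∀ (f : ↥(fineDom ((ℓ + 1) ^ k) Ωc) × Fin 2 → ℝ), (∀ p, ¬ S p.1 → f p = 0) → ∀ i : Fin 2,
        |(regionDeriv OrthFlow.rot e₀ ((ℓ + 1) ^ k) Ωc Ac' μ
            *ᵥ ((regionOp OrthFlow.rot e₀ hn (B1.aSeq a ((ℓ : ℝ) + 1) k) m2 Ωc Ac')⁻¹ *ᵥ f)) (x, i)|
          ≤ C * Real.exp (-(D / (4 * ((((ℓ + 1) ^ k : ℕ) : ℝ) * K)))) * ‖f‖) ∧
      -- (1.9) on `Ω`, all pairs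
      (∀ (μ : Fin (d + 1)) (x x' : ↥(fineDom ((ℓ + 1) ^ k) Ωc)), x.1 + e1 μ ∈ fineDom ((ℓ + 1) ^ k) Ωc →
        x'.1 + e1 μ ∈ fineDom ((ℓ + 1) ^ k) Ωc → x'.1 ≠ x.1 →
        ∀ (l : List ↥(fineDom ((ℓ + 1) ^ k) Ωc)), IsNNChain x l → pathEnd x l = x' →
        (l.length : ℝ) ≤ ((d : ℝ) + 1) * supNorm (x'.1 - x.1) →
        (∀ z ∈ l, supNorm (z.1 - x.1) ≤ supNorm (x'.1 - x.1)) →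
        (∀ y : Fin (d + 1) → ℤ, (∀ ν, |y ν - blk ((ℓ + 1) ^ k) x.1 ν| ≤ (K : ℤ) * (d + 4)) → y ∈ Ωc) →
        (∀ y : Fin (d + 1) → ℤ, (∀ ν, |y ν - blk ((ℓ + 1) ^ k) x'.1 ν| ≤ (K : ℤ) * (d + 4)) → y ∈ Ωc) →
        ∀ (S : ↥(fineDom ((ℓ + 1) ^ k) Ωc) → Prop) (D : ℝ), 0 ≤ D →
        (∀ x'', S x'' → ∃ ν, D ≤ |rpos ((ℓ + 1) ^ k) Ωc x ν - rpos ((ℓ + 1) ^ k) Ωc x'' ν|) →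
        (∀ x'', S x'' → ∃ ν, D ≤ |rpos ((ℓ + 1) ^ k) Ωc x' ν - rpos ((ℓ + 1) ^ k) Ωc x'' ν|) →
        ∀ (f : ↥(fineDom ((ℓ + 1) ^ k) Ωc) × Fin 2 → ℝ), (∀ p, ¬ S p.1 → f p = 0) → ∀ i : Fin 2,
        ((((ℓ + 1) ^ k : ℕ) : ℝ) / supNorm (x'.1 - x.1)) ^ α *
          |(transport (fieldLink OrthFlow.rot (e₀ / ((ℓ + 1) ^ k : ℕ)) (acBond Ωc Ac')) x l
              *ᵥ fld (regionDeriv OrthFlow.rot e₀ ((ℓ + 1) ^ k) Ωc Ac' μ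
                    *ᵥ ((regionOp OrthFlow.rot e₀ hn (B1.aSeq a ((ℓ : ℝ) + 1) k) m2 Ωc Ac')⁻¹ *ᵥ f)) x'
            - fld (regionDeriv OrthFlow.rot e₀ ((ℓ + 1) ^ k) Ωc Ac' μ
                    *ᵥ ((regionOp OrthFlow.rot e₀ hn (B1.aSeq a ((ℓ : ℝ) + 1) k) m2 Ωc Ac')⁻¹ *ᵥ f)) x) i|
          ≤ C * Real.exp (-(D / (4 * ((((ℓ + 1) ^ k : ℕ) : ℝ) * K)))) * ‖f‖) ∧
      -- `δG`, value
      (∀ (x : ↥(fineDom ((ℓ + 1) ^ k) Ωc)),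
        (∀ y : Fin (d + 1) → ℤ, (∀ ν, |y ν - blk ((ℓ + 1) ^ k) x.1 ν| ≤ (K : ℤ) * (d + 4)) → y ∈ Ωc) →
        ∀ (S : ↥(fineDom ((ℓ + 1) ^ k) Ω₀c) → Prop) (D D₀ D₁ : ℝ), 0 ≤ D → 0 ≤ D₀ → 0 ≤ D₁ →
        (∀ x', S x' → ∃ ν, D ≤ |rpos ((ℓ + 1) ^ k) Ω₀c (incl hn hsub x) ν - rpos ((ℓ + 1) ^ k) Ω₀c x' ν|) →
        (∀ x₁ : ↥(fineDom ((ℓ + 1) ^ k) Ω₀c), ¬ inReg ((ℓ + 1) ^ k) Ωc x₁ →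
          ∃ ν, D₀ ≤ |rpos ((ℓ + 1) ^ k) Ω₀c (incl hn hsub x) ν - rpos ((ℓ + 1) ^ k) Ω₀c x₁ ν|) →
        (∀ x', S x' → ∀ x₁ : ↥(fineDom ((ℓ + 1) ^ k) Ω₀c), ¬ inReg ((ℓ + 1) ^ k) Ωc x₁ →
          ∃ ν, D₁ ≤ |rpos ((ℓ + 1) ^ k) Ω₀c x₁ ν - rpos ((ℓ + 1) ^ k) Ω₀c x' ν|) →
        ∀ (f : ↥(fineDom ((ℓ + 1) ^ k) Ω₀c) × Fin 2 → ℝ), (∀ p, ¬ S p.1 → f p = 0) → ∀ i : Fin 2,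
        |((regionOp OrthFlow.rot e₀ hn (B1.aSeq a ((ℓ : ℝ) + 1) k) m2 Ωc Ac')⁻¹
              *ᵥ (fun q : ↥(fineDom ((ℓ + 1) ^ k) Ωc) × Fin 2 => f (incl hn hsub q.1, q.2))) (x, i)
          - ((regionOp OrthFlow.rot e₀ hn (B1.aSeq a ((ℓ : ℝ) + 1) k) m2 Ω₀c Ac')⁻¹ *ᵥ f) (incl hn hsub x, i)|
          ≤ C * Real.exp (-((D₀ + D₁) / (4 * ((((ℓ + 1) ^ k : ℕ) : ℝ) * K))))
            * Real.exp (-(D / (4 * ((((ℓ + 1) ^ k : ℕ) : ℝ) * K)))) * ‖f‖) ∧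
      -- `δG`, derivative
      (∀ (μ : Fin (d + 1)) (x : ↥(fineDom ((ℓ + 1) ^ k) Ωc)), x.1 + e1 μ ∈ fineDom ((ℓ + 1) ^ k) Ωc →
        (∀ y : Fin (d + 1) → ℤ, (∀ ν, |y ν - blk ((ℓ + 1) ^ k) x.1 ν| ≤ (K : ℤ) * (d + 4)) → y ∈ Ωc) →
        ∀ (S : ↥(fineDom ((ℓ + 1) ^ k) Ω₀c) → Prop) (D D₀ D₁ : ℝ), 0 ≤ D → 0 ≤ D₀ → 0 ≤ D₁ →
        (∀ x', S x' → ∃ ν, D ≤ |rpos ((ℓ + 1) ^ k) Ω₀c (incl hn hsub x) ν - rpos ((ℓ + 1) ^ k) Ω₀c x' ν|) →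
        (∀ x₁ : ↥(fineDom ((ℓ + 1) ^ k) Ω₀c), ¬ inReg ((ℓ + 1) ^ k) Ωc x₁ →
          ∃ ν, D₀ ≤ |rpos ((ℓ + 1) ^ k) Ω₀c (incl hn hsub x) ν - rpos ((ℓ + 1) ^ k) Ω₀c x₁ ν|) →
        (∀ x', S x' → ∀ x₁ : ↥(fineDom ((ℓ + 1) ^ k) Ω₀c), ¬ inReg ((ℓ + 1) ^ k) Ωc x₁ →
          ∃ ν, D₁ ≤ |rpos ((ℓ + 1) ^ k) Ω₀c x₁ ν - rpos ((ℓ + 1) ^ k) Ω₀c x' ν|) →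
        ∀ (f : ↥(fineDom ((ℓ + 1) ^ k) Ω₀c) × Fin 2 → ℝ), (∀ p, ¬ S p.1 → f p = 0) → ∀ i : Fin 2,
        |(regionDeriv OrthFlow.rot e₀ ((ℓ + 1) ^ k) Ωc Ac' μ
              *ᵥ ((regionOp OrthFlow.rot e₀ hn (B1.aSeq a ((ℓ : ℝ) + 1) k) m2 Ωc Ac')⁻¹
                *ᵥ (fun q : ↥(fineDom ((ℓ + 1) ^ k) Ωc) × Fin 2 => f (incl hn hsub q.1, q.2)))) (x, i)
          - (regionDeriv OrthFlow.rot e₀ ((ℓ + 1) ^ k) Ω₀c Ac' μ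
              *ᵥ ((regionOp OrthFlow.rot e₀ hn (B1.aSeq a ((ℓ : ℝ) + 1) k) m2 Ω₀c Ac')⁻¹ *ᵥ f)) (incl hn hsub x, i)|
          ≤ C * Real.exp (-((D₀ + D₁) / (4 * ((((ℓ + 1) ^ k : ℕ) : ℝ) * K))))
            * Real.exp (-(D / (4 * ((((ℓ + 1) ^ k : ℕ) : ℝ) * K)))) * ‖f‖) ∧
      -- `δG`, Hölder, all pairs
      (∀ (μ : Fin (d + 1)) (x x' : ↥(fineDom ((ℓ + 1) ^ k) Ωc)), x.1 + e1 μ ∈ fineDom ((ℓ + 1) ^ k) Ωc →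
        x'.1 + e1 μ ∈ fineDom ((ℓ + 1) ^ k) Ωc → x'.1 ≠ x.1 →
        ∀ (l : List ↥(fineDom ((ℓ + 1) ^ k) Ωc)), IsNNChain x l → pathEnd x l = x' →
        (l.length : ℝ) ≤ ((d : ℝ) + 1) * supNorm (x'.1 - x.1) →
        (∀ z ∈ l, supNorm (z.1 - x.1) ≤ supNorm (x'.1 - x.1)) →
        (∀ y : Fin (d + 1) → ℤ, (∀ ν, |y ν - blk ((ℓ + 1) ^ k) x.1 ν| ≤ (K : ℤ) * (d + 4)) → y ∈ Ωc) →
        (∀ y : Fin (d + 1) → ℤ, (∀ ν, |y ν - blk ((ℓ + 1) ^ k) x'.1 ν| ≤ (K : ℤ) * (d + 4)) → y ∈ Ωc) →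
        ∀ (S : ↥(fineDom ((ℓ + 1) ^ k) Ω₀c) → Prop) (D D₀ D₁ : ℝ), 0 ≤ D → 0 ≤ D₀ → 0 ≤ D₁ →
        (∀ x'', S x'' → ∃ ν, D ≤ |rpos ((ℓ + 1) ^ k) Ω₀c (incl hn hsub x) ν - rpos ((ℓ + 1) ^ k) Ω₀c x'' ν|) →
        (∀ x'', S x'' → ∃ ν, D ≤ |rpos ((ℓ + 1) ^ k) Ω₀c (incl hn hsub x') ν - rpos ((ℓ + 1) ^ k) Ω₀c x'' ν|) →
        (∀ x₁ : ↥(fineDom ((ℓ + 1) ^ k) Ω₀c), ¬ inReg ((ℓ + 1) ^ k) Ωc x₁ →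
          ∃ ν, D₀ ≤ |rpos ((ℓ + 1) ^ k) Ω₀c (incl hn hsub x) ν - rpos ((ℓ + 1) ^ k) Ω₀c x₁ ν|) →
        (∀ x₁ : ↥(fineDom ((ℓ + 1) ^ k) Ω₀c), ¬ inReg ((ℓ + 1) ^ k) Ωc x₁ →
          ∃ ν, D₀ ≤ |rpos ((ℓ + 1) ^ k) Ω₀c (incl hn hsub x') ν - rpos ((ℓ + 1) ^ k) Ω₀c x₁ ν|) →
        (∀ x'', S x'' → ∀ x₁ : ↥(fineDom ((ℓ + 1) ^ k) Ω₀c), ¬ inReg ((ℓ + 1) ^ k) Ωc x₁ →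
          ∃ ν, D₁ ≤ |rpos ((ℓ + 1) ^ k) Ω₀c x₁ ν - rpos ((ℓ + 1) ^ k) Ω₀c x'' ν|) →
        ∀ (f : ↥(fineDom ((ℓ + 1) ^ k) Ω₀c) × Fin 2 → ℝ), (∀ p, ¬ S p.1 → f p = 0) → ∀ i : Fin 2,
        ((((ℓ + 1) ^ k : ℕ) : ℝ) / supNorm (x'.1 - x.1)) ^ α *
          |(transport (fieldLink OrthFlow.rot (e₀ / ((ℓ + 1) ^ k : ℕ)) (acBond Ωc Ac')) x l
              *ᵥ fld (regionDeriv OrthFlow.rot e₀ ((ℓ + 1) ^ k) Ωc Ac' μ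
                    *ᵥ ((regionOp OrthFlow.rot e₀ hn (B1.aSeq a ((ℓ : ℝ) + 1) k) m2 Ωc Ac')⁻¹
                      *ᵥ (fun q : ↥(fineDom ((ℓ + 1) ^ k) Ωc) × Fin 2 => f (incl hn hsub q.1, q.2)))) x'
            - fld (regionDeriv OrthFlow.rot e₀ ((ℓ + 1) ^ k) Ωc Ac' μ
                    *ᵥ ((regionOp OrthFlow.rot e₀ hn (B1.aSeq a ((ℓ : ℝ) + 1) k) m2 Ωc Ac')⁻¹
                      *ᵥ (fun q : ↥(fineDom ((ℓ + 1) ^ k) Ωc) × Fin 2 => f (incl hn hsub q.1, q.2)))) x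
            - (transport (fieldLink OrthFlow.rot (e₀ / ((ℓ + 1) ^ k : ℕ)) (acBond Ωc Ac')) x l
                *ᵥ fld (regionDeriv OrthFlow.rot e₀ ((ℓ + 1) ^ k) Ω₀c Ac' μ
                      *ᵥ ((regionOp OrthFlow.rot e₀ hn (B1.aSeq a ((ℓ : ℝ) + 1) k) m2 Ω₀c Ac')⁻¹ *ᵥ f)) (incl hn hsub x')
              - fld (regionDeriv OrthFlow.rot e₀ ((ℓ + 1) ^ k) Ω₀c Ac' μ
                      *ᵥ ((regionOp OrthFlow.rot e₀ hn (B1.aSeq a ((ℓ : ℝ) + 1) k) m2 Ω₀c Ac')⁻¹ *ᵥ f)) (incl hn hsub x))) i|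
          ≤ C * Real.exp (-((D₀ + D₁) / (4 * ((((ℓ + 1) ^ k : ℕ) : ℝ) * K))))
            * Real.exp (-(D / (4 * ((((ℓ + 1) ^ k : ℕ) : ℝ) * K)))) * ‖f‖) := by
  obtain ⟨K, hK16, HK⟩ := region_pair_members OrthFlow.rot zero_le_one rot_lipschitz d ℓ hℓ amin aplus m2plus ha
  refine ⟨K, hK16, fun α hα0 hα1 => ?_⟩
  obtain ⟨C, hC, HC⟩ := HK α hα0 hα1
  refine ⟨4 * C, by positivity, fun c β hc hβ0 hβ1 => ?_⟩
  obtain ⟨e₁', he₁', H'⟩ := HC c β hc.le hβ0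
  obtain ⟨e₁, he₁, hall⟩ := exists_smooth_gauge_links hd hℓ hodd pexp n hβ1 hc
  refine ⟨min e₁ e₁', lt_min he₁ he₁', fun P hPd hPL k hk1 hk e₀ he hle v hv lo hi hbox hnN hn a m2 ha1 ha2 hm1 hm2 Ω₀c Ωc hBU₀ hBU hsub
    hΩ₀ Ac' hlog => ?_⟩
  -- the smooth gauge on the LARGER region `Ω₀` (it serves `Ω ⊂ Ω₀` as well), abbreviated `Ah`, and the gauge function `sg = −(ℓ+1)^k·λ`
  obtain ⟨lam, A, hregA, hlinks⟩ := hall P hPd hPL k hk1 hk e₀ he (hle.trans (min_le_left _ _)) v hv lo hi hbox hnN Ω₀c hΩ₀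
  have hlinkA := hlinks Ac' hlog
  obtain ⟨Ah, hAh_def⟩ : ∃ Ah : (Fin (d + 1) → ℤ) → Fin (d + 1) → ℝ,
      Ah = fun x ν => A ⟨castSite (fun j : Fin P.d => x (Fin.cast hPd j)), Fin.cast hPd.symm ν⟩ := ⟨_, rfl⟩
  obtain ⟨sg, hsg_def⟩ : ∃ sg : (Fin (d + 1) → ℤ) → ℝ,
      sg = fun x => -((((ℓ + 1) ^ k : ℕ) : ℝ) * lam (castSite (fun j : Fin P.d => x (Fin.cast hPd j)))) := ⟨_, rfl⟩
  have hreg : ∀ x ∈ fineDom ((ℓ + 1) ^ k) Ω₀c, ∀ μ ν : Fin (d + 1),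
      |Ah (x + e1 μ) ν - Ah x ν| ≤ c * e₀ ^ (β - 1) / (((ℓ + 1) ^ k : ℕ) : ℝ) := by
    rw [hAh_def]; exact hregA
  have hlink₀ : ∀ x ∈ fineDom ((ℓ + 1) ^ k) Ω₀c, ∀ ν : Fin (d + 1), x + e1 ν ∈ fineDom ((ℓ + 1) ^ k) Ω₀c →
      OrthFlow.rot.U (e₀ / (((ℓ + 1) ^ k : ℕ) : ℝ) * Ac' x ν)
        = OrthFlow.rot.U (e₀ / (((ℓ + 1) ^ k : ℕ) : ℝ) * (Ah x ν + sg x - sg (x + e1 ν))) := by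
    rw [hAh_def, hsg_def]; exact hlinkA
  have hmono : fineDom ((ℓ + 1) ^ k) Ωc ⊆ fineDom ((ℓ + 1) ^ k) Ω₀c := fun z hz =>
    (mem_fineDom hn).mpr (hsub ((mem_fineDom hn).mp hz))
  have hlink : ∀ x ∈ fineDom ((ℓ + 1) ^ k) Ωc, ∀ ν : Fin (d + 1), x + e1 ν ∈ fineDom ((ℓ + 1) ^ k) Ωc →
      OrthFlow.rot.U (e₀ / (((ℓ + 1) ^ k : ℕ) : ℝ) * Ac' x ν)
        = OrthFlow.rot.U (e₀ / (((ℓ + 1) ^ k : ℕ) : ℝ) * (Ah x ν + sg x - sg (x + e1 ν))) :=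
    fun x hx ν hν => hlink₀ x (hmono hx) ν (hmono hν)
  -- one sitewise gauge, restricted to either region
  obtain ⟨g₀, hg₀_def⟩ : ∃ g₀ : ↥(fineDom ((ℓ + 1) ^ k) Ω₀c) → Matrix (Fin 2) (Fin 2) ℝ,
      g₀ = fun u => OrthFlow.rot.U (e₀ / (((ℓ + 1) ^ k : ℕ) : ℝ) * sg u.1) := ⟨_, rfl⟩
  obtain ⟨g, hg_def⟩ : ∃ g : ↥(fineDom ((ℓ + 1) ^ k) Ωc) → Matrix (Fin 2) (Fin 2) ℝ,
      g = fun u => OrthFlow.rot.U (e₀ / (((ℓ + 1) ^ k : ℕ) : ℝ) * sg u.1) := ⟨_, rfl⟩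
  have hg₀ : IsGauge g₀ := by rw [hg₀_def]; exact OrthFlow.rot.isGauge _
  have hg : IsGauge g := by rw [hg_def]; exact OrthFlow.rot.isGauge _
  have hgg : ∀ q : ↥(fineDom ((ℓ + 1) ^ k) Ωc), g q = g₀ (incl hn hsub q) := fun q => by rw [hg_def, hg₀_def]; rfl
  have hop₀ : regionOp OrthFlow.rot e₀ hn (B1.aSeq a ((ℓ : ℝ) + 1) k) m2 Ω₀c Ac'
      = blockDiag g₀ * regionOp OrthFlow.rot e₀ hn (B1.aSeq a ((ℓ : ℝ) + 1) k) m2 Ω₀c Ah * (blockDiag g₀)ᵀ := by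
    rw [hg₀_def]
    exact regionOp_gauge OrthFlow.rot e₀ hn (B1.aSeq a ((ℓ : ℝ) + 1) k) m2 Ω₀c (Ac := Ah) (σ := sg) hlink₀
  have hop : regionOp OrthFlow.rot e₀ hn (B1.aSeq a ((ℓ : ℝ) + 1) k) m2 Ωc Ac'
      = blockDiag g * regionOp OrthFlow.rot e₀ hn (B1.aSeq a ((ℓ : ℝ) + 1) k) m2 Ωc Ah * (blockDiag g)ᵀ := by
    rw [hg_def]
    exact regionOp_gauge OrthFlow.rot e₀ hn (B1.aSeq a ((ℓ : ℝ) + 1) k) m2 Ωc (Ac := Ah) (σ := sg) hlink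
  have hDer₀ : ∀ μ : Fin (d + 1), regionDeriv OrthFlow.rot e₀ ((ℓ + 1) ^ k) Ω₀c Ac' μ
      = blockDiag g₀ * regionDeriv OrthFlow.rot e₀ ((ℓ + 1) ^ k) Ω₀c Ah μ * (blockDiag g₀)ᵀ := by
    intro μ; rw [hg₀_def]
    exact regionDeriv_gauge OrthFlow.rot e₀ ((ℓ + 1) ^ k) Ω₀c (Ac := Ah) (σ := sg) hlink₀ μ
  have hDer : ∀ μ : Fin (d + 1), regionDeriv OrthFlow.rot e₀ ((ℓ + 1) ^ k) Ωc Ac' μ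
      = blockDiag g * regionDeriv OrthFlow.rot e₀ ((ℓ + 1) ^ k) Ωc Ah μ * (blockDiag g)ᵀ := by
    intro μ; rw [hg_def]
    exact regionDeriv_gauge OrthFlow.rot e₀ ((ℓ + 1) ^ k) Ωc (Ac := Ah) (σ := sg) hlink μ
  have hT : ∀ (x : ↥(fineDom ((ℓ + 1) ^ k) Ωc)) (l : List ↥(fineDom ((ℓ + 1) ^ k) Ωc)), IsNNChain x l →
      transport (fieldLink OrthFlow.rot (e₀ / ((ℓ + 1) ^ k : ℕ)) (acBond Ωc Ac')) x l
        = g x * transport (fieldLink OrthFlow.rot (e₀ / ((ℓ + 1) ^ k : ℕ)) (acBond Ωc Ah)) x l * (g (pathEnd x l))ᵀ := by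
    intro x l hl; rw [hg_def]
    exact transport_acBond_gauge OrthFlow.rot e₀ ((ℓ + 1) ^ k) Ωc (Ac := Ah) (σ := sg) hlink x l hl
  -- transformed sources: supports, sup norms, restriction
  have hfT : ∀ (S : ↥(fineDom ((ℓ + 1) ^ k) Ωc) → Prop) (f : ↥(fineDom ((ℓ + 1) ^ k) Ωc) × Fin 2 → ℝ),
      (∀ p, ¬ S p.1 → f p = 0) → ∀ p : ↥(fineDom ((ℓ + 1) ^ k) Ωc) × Fin 2, ¬ S p.1 → ((blockDiag g)ᵀ *ᵥ f) p = 0 := by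
    rintro S f hf ⟨y, j⟩ hy
    rw [blockDiagT_mulVec_apply]
    exact Finset.sum_eq_zero fun j' _ => by rw [hf (y, j') hy, mul_zero]
  have hfT₀ : ∀ (S : ↥(fineDom ((ℓ + 1) ^ k) Ω₀c) → Prop) (f : ↥(fineDom ((ℓ + 1) ^ k) Ω₀c) × Fin 2 → ℝ),
      (∀ p, ¬ S p.1 → f p = 0) → ∀ p : ↥(fineDom ((ℓ + 1) ^ k) Ω₀c) × Fin 2, ¬ S p.1 → ((blockDiag g₀)ᵀ *ᵥ f) p = 0 := by
    rintro S f hf ⟨y, j⟩ hy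
    rw [blockDiagT_mulVec_apply]
    exact Finset.sum_eq_zero fun j' _ => by rw [hf (y, j') hy, mul_zero]
  have hnT : ∀ f : ↥(fineDom ((ℓ + 1) ^ k) Ωc) × Fin 2 → ℝ, ‖(blockDiag g)ᵀ *ᵥ f‖ ≤ 2 * ‖f‖ := fun f => by
    have h := norm_blockDiagT_mulVec_le hg f
    simp only [Fintype.card_fin, Nat.cast_ofNat] at h
    exact h
  have hnT₀ : ∀ f : ↥(fineDom ((ℓ + 1) ^ k) Ω₀c) × Fin 2 → ℝ, ‖(blockDiag g₀)ᵀ *ᵥ f‖ ≤ 2 * ‖f‖ := fun f => by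
    have h := norm_blockDiagT_mulVec_le hg₀ f
    simp only [Fintype.card_fin, Nat.cast_ofNat] at h
    exact h
  have hresT : ∀ f : ↥(fineDom ((ℓ + 1) ^ k) Ω₀c) × Fin 2 → ℝ,
      (fun q : ↥(fineDom ((ℓ + 1) ^ k) Ωc) × Fin 2 => ((blockDiag g₀)ᵀ *ᵥ f) (incl hn hsub q.1, q.2))
        = (blockDiag g)ᵀ *ᵥ (fun q : ↥(fineDom ((ℓ + 1) ^ k) Ωc) × Fin 2 => f (incl hn hsub q.1, q.2)) := by
    intro f
    funext q
    obtain ⟨y, j⟩ := q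
    show ((blockDiag g₀)ᵀ *ᵥ f) (incl hn hsub y, j) = _
    rw [blockDiagT_mulVec_apply, blockDiagT_mulVec_apply, hgg]
  -- r01's six members at the smooth gauge `Ah` (regular (1.7) on `Ω₀` with the constants `(c, β)`)
  obtain ⟨V, Dm, Hm, dV, dD, dH⟩ := H' k hk1 hn a m2 ha1 ha2 hm1 hm2 Ω₀c Ωc hBU₀ hBU hsub Ah e₀ he
    (hle.trans (min_le_right _ _)) hreg
  have hE1 : ∀ D : ℝ, 0 ≤ C * Real.exp (-(D / (4 * ((((ℓ + 1) ^ k : ℕ) : ℝ) * K)))) := fun D => by positivity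
  have hE2 : ∀ D D₀ D₁ : ℝ, 0 ≤ C * Real.exp (-((D₀ + D₁) / (4 * ((((ℓ + 1) ^ k : ℕ) : ℝ) * K))))
      * Real.exp (-(D / (4 * ((((ℓ + 1) ^ k : ℕ) : ℝ) * K)))) := fun D D₀ D₁ => by positivity
  refine ⟨?_, ?_, ?_, ?_, ?_, ?_⟩
  ---------------------------------------------------------------- (1.10), value, on `Ω`
  · intro x hR S D hD0 hD f hf i
    rw [hop, conj_inv hg, ← Matrix.mulVec_mulVec, ← Matrix.mulVec_mulVec]
    refine (abs_blockDiag_mulVec_apply_le hg _ x i).trans ?_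
    calc ∑ j : Fin 2, |((regionOp OrthFlow.rot e₀ hn (B1.aSeq a ((ℓ : ℝ) + 1) k) m2 Ωc Ah)⁻¹ *ᵥ ((blockDiag g)ᵀ *ᵥ f)) (x, j)|
        ≤ ∑ _j : Fin 2, C * Real.exp (-(D / (4 * ((((ℓ + 1) ^ k : ℕ) : ℝ) * K)))) * (2 * ‖f‖) :=
          Finset.sum_le_sum fun j _ =>
            (V x hR S D hD0 hD _ (hfT S f hf) j).trans (mul_le_mul_of_nonneg_left (hnT f) (hE1 D))
      _ = 4 * C * Real.exp (-(D / (4 * ((((ℓ + 1) ^ k : ℕ) : ℝ) * K)))) * ‖f‖ := by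
          simp only [Finset.sum_const, Finset.card_univ, Fintype.card_fin, nsmul_eq_mul, Nat.cast_ofNat]
          ring
  ---------------------------------------------------------------- (1.10), derivative, on `Ω`
  · intro μ x hxμ hR S D hD0 hD f hf i
    rw [hop, hDer μ, conj_inv hg, conj_deriv_green_mulVec hg]
    refine (abs_blockDiag_mulVec_apply_le hg _ x i).trans ?_
    calc ∑ j : Fin 2, |(regionDeriv OrthFlow.rot e₀ ((ℓ + 1) ^ k) Ωc Ah μ *ᵥ
            ((regionOp OrthFlow.rot e₀ hn (B1.aSeq a ((ℓ : ℝ) + 1) k) m2 Ωc Ah)⁻¹ *ᵥ ((blockDiag g)ᵀ *ᵥ f))) (x, j)|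
        ≤ ∑ _j : Fin 2, C * Real.exp (-(D / (4 * ((((ℓ + 1) ^ k : ℕ) : ℝ) * K)))) * (2 * ‖f‖) :=
          Finset.sum_le_sum fun j _ =>
            (Dm μ x hxμ hR S D hD0 hD _ (hfT S f hf) j).trans (mul_le_mul_of_nonneg_left (hnT f) (hE1 D))
      _ = 4 * C * Real.exp (-(D / (4 * ((((ℓ + 1) ^ k : ℕ) : ℝ) * K)))) * ‖f‖ := by
          simp only [Finset.sum_const, Finset.card_univ, Fintype.card_fin, nsmul_eq_mul, Nat.cast_ofNat]
          ring
  ---------------------------------------------------------------- (1.9) on `Ω`, all pairs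
  · intro μ x x' hxμ hx'μ hne l hl hlend hlen hlnear hRx hRx' S D hD0 hD hD' f hf i
    have hw : 0 ≤ ((((ℓ + 1) ^ k : ℕ) : ℝ) / supNorm (x'.1 - x.1)) ^ α :=
      Real.rpow_nonneg (div_nonneg (Nat.cast_nonneg _) (supNorm_nonneg _)) α
    have hTl := hT x l hl
    rw [hlend] at hTl
    rw [hop, hDer μ, hTl, conj_inv hg, conj_deriv_green_mulVec hg, holderExpr_conj hg]
    have key := fun j : Fin 2 =>
      (Hm μ x x' hxμ hx'μ hne l hl hlend hlen hlnear hRx hRx' S D hD0 hD hD' _ (hfT S f hf) j).trans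
        (mul_le_mul_of_nonneg_left (hnT f) (hE1 D))
    refine (mul_le_mul_of_nonneg_left (abs_gauge_mulVec_le hg x _ i) hw).trans ?_
    rw [Finset.mul_sum]
    refine (Finset.sum_le_sum fun j _ => key j).trans (le_of_eq ?_)
    simp only [Finset.sum_const, Finset.card_univ, Fintype.card_fin, nsmul_eq_mul, Nat.cast_ofNat]
    ring
  ---------------------------------------------------------------- `δG`, value
  · intro x hR S D D₀ D₁ hD0 hD₀0 hD₁0 hD hD₀ hD₁ f hf i
    have hval : ∀ j : Fin 2,
        ((regionOp OrthFlow.rot e₀ hn (B1.aSeq a ((ℓ : ℝ) + 1) k) m2 Ωc Ac')⁻¹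
            *ᵥ (fun q : ↥(fineDom ((ℓ + 1) ^ k) Ωc) × Fin 2 => f (incl hn hsub q.1, q.2))) (x, j)
          - ((regionOp OrthFlow.rot e₀ hn (B1.aSeq a ((ℓ : ℝ) + 1) k) m2 Ω₀c Ac')⁻¹ *ᵥ f) (incl hn hsub x, j)
        = (g x *ᵥ (fld ((regionOp OrthFlow.rot e₀ hn (B1.aSeq a ((ℓ : ℝ) + 1) k) m2 Ωc Ah)⁻¹
              *ᵥ ((blockDiag g)ᵀ *ᵥ fun q : ↥(fineDom ((ℓ + 1) ^ k) Ωc) × Fin 2 => f (incl hn hsub q.1, q.2))) x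
            - fld ((regionOp OrthFlow.rot e₀ hn (B1.aSeq a ((ℓ : ℝ) + 1) k) m2 Ω₀c Ah)⁻¹
              *ᵥ ((blockDiag g₀)ᵀ *ᵥ f)) (incl hn hsub x))) j := by
      intro j
      rw [hop, hop₀, conj_inv hg, conj_inv hg₀, ← Matrix.mulVec_mulVec, ← Matrix.mulVec_mulVec, ← Matrix.mulVec_mulVec,
        ← Matrix.mulVec_mulVec]
      exact gauge_pair_apply (hgg x) _ _ j
    rw [hval i]
    refine (abs_gauge_mulVec_le hg x _ i).trans ?_
    have key := fun j' : Fin 2 =>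
      (dV x hR S D D₀ D₁ hD0 hD₀0 hD₁0 hD hD₀ hD₁ _ (hfT₀ S f hf) j').trans (mul_le_mul_of_nonneg_left (hnT₀ f) (hE2 D D₀ D₁))
    rw [← hresT f]
    simp only [Pi.sub_apply, fld_apply]
    refine (Finset.sum_le_sum fun j' _ => key j').trans (le_of_eq ?_)
    simp only [Finset.sum_const, Finset.card_univ, Fintype.card_fin, nsmul_eq_mul, Nat.cast_ofNat]
    ring
  ---------------------------------------------------------------- `δG`, derivative
  · intro μ x hxμ hR S D D₀ D₁ hD0 hD₀0 hD₁0 hD hD₀ hD₁ f hf i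
    rw [hop, hop₀, hDer μ, hDer₀ μ, conj_inv hg, conj_inv hg₀, conj_deriv_green_mulVec hg, conj_deriv_green_mulVec hg₀,
      gauge_pair_apply (hgg x)]
    refine (abs_gauge_mulVec_le hg x _ i).trans ?_
    have key := fun j' : Fin 2 =>
      (dD μ x hxμ hR S D D₀ D₁ hD0 hD₀0 hD₁0 hD hD₀ hD₁ _ (hfT₀ S f hf) j').trans
        (mul_le_mul_of_nonneg_left (hnT₀ f) (hE2 D D₀ D₁))
    rw [← hresT f]
    simp only [Pi.sub_apply, fld_apply]
    refine (Finset.sum_le_sum fun j' _ => key j').trans (le_of_eq ?_)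
    simp only [Finset.sum_const, Finset.card_univ, Fintype.card_fin, nsmul_eq_mul, Nat.cast_ofNat]
    ring
  ---------------------------------------------------------------- `δG`, Hölder, all pairs
  · intro μ x x' hxμ hx'μ hne l hl hlend hlen hlnear hRx hRx' S D D₀ D₁ hD0 hD₀0 hD₁0 hD hD' hD₀ hD₀' hD₁ f hf i
    have hw : 0 ≤ ((((ℓ + 1) ^ k : ℕ) : ℝ) / supNorm (x'.1 - x.1)) ^ α :=
      Real.rpow_nonneg (div_nonneg (Nat.cast_nonneg _) (supNorm_nonneg _)) α
    have hTl := hT x l hl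
    rw [hlend] at hTl
    rw [hop, hop₀, hDer μ, hDer₀ μ, hTl, conj_inv hg, conj_inv hg₀, conj_deriv_green_mulVec hg, conj_deriv_green_mulVec hg₀,
      gauge_holderPair hg hg₀ (hgg x) (hgg x')]
    have key := fun j' : Fin 2 =>
      (dH μ x x' hxμ hx'μ hne l hl hlend hlen hlnear hRx hRx' S D D₀ D₁ hD0 hD₀0 hD₁0 hD hD' hD₀ hD₀' hD₁ _ (hfT₀ S f hf) j').trans
        (mul_le_mul_of_nonneg_left (hnT₀ f) (hE2 D D₀ D₁))
    refine (mul_le_mul_of_nonneg_left (abs_gauge_mulVec_le hg x _ i) hw).trans ?_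
    rw [Finset.mul_sum, ← hresT f]
    refine (Finset.sum_le_sum fun j' _ => key j').trans (le_of_eq ?_)
    simp only [Finset.sum_const, Finset.card_univ, Fintype.card_fin, nsmul_eq_mul, Nat.cast_ofNat]
    ring

end Members

/-! ## §2  The instances arising from the actual background, and the family of settings -/

section Family

/-- **AN INSTANCE OF [7]'s THEOREM ARISING FROM `Δ_k(u_k)`** ([BalabanImbrieJaffe1985] p. 326): r01's `RegionPairInst` (scale `k ≥ 1`,
pair `Ω ⊆ Ω₀` of finite sets of unit labels, `(a, m²)` in the windows, a component field `A_c` on the fine lattice, a coupling `e`)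
EXTENDED by the Sect. 7.3 data it comes from: a torus `P` with `P.d = d + 1`, `P.L = ℓ + 1` and `k ≤ m + K`, a unit `U(1)` field `v` on
`T^{(k)}`, a non-wrapping box `[lo, hi]` of side `≤ n < |T|` containing the blocks of `Ω₀` with one bond of slack, and the LOGARITHM RELATION:
`A_c` is a logarithm field of the actual background `u_k = u_k(e, v)` of (4.5.4) on the bonds of `Ω₀`,
`exp(i(e/(ℓ+1)^k)A_{c,ν}(x)) = u_k(⟨x, x + e_ν⟩)` — so that r01's printed objects at `A_c` ARE [7]'s operators fed with the bond variables
of `u_k` (file 4 `regionOp_logField_eq`: independent of the logarithm chosen). [cite: BalabanImbrieJaffe1985, §7.3 p.326, (4.5.4) p.313; Balaban1983RegularityDecay, (1.1)–(1.6) p.572] -/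
structure ActualBgInst (d ℓ : ℕ) (hd : 1 ≤ d) (n : ℕ) (amin aplus m2plus : ℝ)
    extends RegionPairInst d ℓ amin aplus m2plus where
  /-- the torus -/
  P : Params
  hPd : P.d = d + 1
  hPL : P.L = ℓ + 1
  hkK : k ≤ P.m + P.K
  /-- the unit `U(1)` field on `T^{(k)}` -/
  v : U1Field P k
  /-- the box -/
  lo : Fin P.d → ℤ
  hi : Fin P.d → ℤ
  hbox : ∀ κ, hi κ ≤ lo κ + n
  hnP : n < P.sitesPerDir 0
  hin : ∀ y ∈ Ω₀c, ∀ i : Fin (d + 1),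
    lo (Fin.cast hPd.symm i) ≤ (P.L : ℤ) ^ k * y i ∧ (P.L : ℤ) ^ k * y i + (P.L : ℤ) ^ k ≤ hi (Fin.cast hPd.symm i)
  /-- `A_c` is a logarithm field of `u_k(e, v)` on the bonds of `Ω₀` -/
  hlog : ∀ x ∈ fineDom ((ℓ + 1) ^ k) Ω₀c, ∀ ν : Fin (d + 1), x + e1 ν ∈ fineDom ((ℓ + 1) ^ k) Ω₀c →
    Circle.exp (e / (((ℓ + 1) ^ k : ℕ) : ℝ) * Ac x ν) =
      actualBg ((Nat.succ_le_succ hd).trans_eq hPd.symm) k e v ⟨castSite (fun j : Fin P.d => x (Fin.cast hPd j)), Fin.cast hPd.symm ν⟩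

/-- **THE FAMILY OF SETTINGS ARISING FROM `Δ_k(u_k)` UNDER (7.3.1)**: at an instance, r01's setting `regionPairFam rot d ℓ a₋ a₊ m²₊ · · K`
of the Theorem on general pairs (its sites, sources, distances `dist(x, supp f)`, `dist(x, Ω^c)`, `dist(supp f, Ω^c)`, `‖f‖_∞`, the Hölder
quotient with the transporter `U(A(Γ_{x,x′}))`, `|D^η_{A,μ}G_k(Ω,A)f(x)|`, `|G_k(Ω,A)f(x)|`, the `δG_k(Ω,Ω₀,A)` versions, `lower18`, `bigBlocks` =
unions of `K`-blocks, `rect := False`) EVALUATED AT THE LOGARITHM FIELD `A_c` OF `u_k` — i.e. [7]'s objects for the operators arising from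
`Δ_k(u_k)` — with the hypothesis slot `regular` := (7.3.1) `|v(∂p) − 1| ≤ e(1 + log e⁻¹)^p` for all plaquettes («under the restriction (7.3.1)
on the gauge field»; the (1.7) constants of r01's family are irrelevant here and set to `0`).
[cite: BalabanImbrieJaffe1985, §7.3 (7.3.1) p.326; Balaban1983RegularityDecay, Theorem p.573, (1.1)–(1.8) pp.572–573] -/
def actualBgFam (d ℓ : ℕ) (hd : 1 ≤ d) (pexp : ℝ) (n : ℕ) (amin aplus m2plus : ℝ) (K : ℕ)
    (j : ActualBgInst d ℓ hd n amin aplus m2plus) : EtaSetting :=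
  { regionPairFam OrthFlow.rot d ℓ amin aplus m2plus 0 0 K j.toRegionPairInst with
    regular := ∀ p : TPlaq j.P j.k, ‖((plaq j.v p : Circle) : ℂ) - 1‖ ≤ j.e * (1 + Real.log j.e⁻¹) ^ pexp }

/-- unfolding: every field of `actualBgFam` other than `regular` is r01's. [cite: Balaban1983RegularityDecay, Theorem p.573, dictionary] -/
theorem actualBgFam_eq (d ℓ : ℕ) (hd : 1 ≤ d) (pexp : ℝ) (n : ℕ) (amin aplus m2plus : ℝ) (K : ℕ)
    (j : ActualBgInst d ℓ hd n amin aplus m2plus) :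
    actualBgFam d ℓ hd pexp n amin aplus m2plus K j =
      { regionPairFam OrthFlow.rot d ℓ amin aplus m2plus 0 0 K j.toRegionPairInst with
        regular := ∀ p : TPlaq j.P j.k, ‖((plaq j.v p : Circle) : ℂ) - 1‖ ≤ j.e * (1 + Real.log j.e⁻¹) ^ pexp } := rfl

/-- THE BIG-BLOCK SIZE `K` of `bigBlocks` (the `K` of `region_pair_members_actualBg`; before `α`).
[cite: Balaban1983RegularityDecay, p.572 «big blocks … cubes of the size M», dictionary] -/
def KmodBg {d ℓ : ℕ} (hd : 1 ≤ d) (hℓ : 1 ≤ ℓ) (hodd : Odd (ℓ + 1)) (pexp : ℝ) (n : ℕ) (amin aplus m2plus : ℝ)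
    (ha : 0 < amin) : ℕ :=
  Classical.choose (region_pair_members_actualBg hd hℓ hodd pexp n amin aplus m2plus ha)

/-- `16 ≤ KmodBg`. [cite: Balaban1983RegularityDecay, p.572, dictionary] -/
theorem KmodBg_ge {d ℓ : ℕ} (hd : 1 ≤ d) (hℓ : 1 ≤ ℓ) (hodd : Odd (ℓ + 1)) (pexp : ℝ) (n : ℕ) (amin aplus m2plus : ℝ)
    (ha : 0 < amin) : 16 ≤ KmodBg hd hℓ hodd pexp n amin aplus m2plus ha :=
  (Classical.choose_spec (region_pair_members_actualBg hd hℓ hodd pexp n amin aplus m2plus ha)).1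

/-- **NON-VACUITY**: for every block size `K ≥ 1`, threshold `e₁ > 0` and box size `n ≥ (K+1)(ℓ+1)` there are instances satisfying
`regular` (7.3.1), `bigBlocks` and `0 < e ≤ e₁` — e.g. the torus `T` with `P = (d+1, ℓ+1, m := n, K := 0)`, scale `k = 1`, the trivial
field `v = 1`, the box `[0, n]^{d+1}`, `Ω = Ω₀ =` one `K`-cube of unit labels, `A_c` the principal logarithm of `u_1(e, 1)`, `(a, m²) =
(a₋, 0)`, `e = min(e₁, 1)`. [cite: BalabanImbrieJaffe1985, §7.3 (7.3.1) p.326; Balaban1983RegularityDecay, Theorem p.573, dictionary] -/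
theorem hypotheses_met_actualBg {d ℓ : ℕ} (hd : 1 ≤ d) (hℓ : 1 ≤ ℓ) (hodd : Odd (ℓ + 1)) (pexp : ℝ) {n : ℕ} {amin aplus m2plus : ℝ}
    (hap : amin ≤ aplus) (hm : 0 ≤ m2plus) (K : ℕ) (hK : 1 ≤ K) (hKn : (K + 1) * (ℓ + 1) ≤ n) (e₁ : ℝ) (he₁ : 0 < e₁) :
    ∃ j : ActualBgInst d ℓ hd n amin aplus m2plus,
      (actualBgFam d ℓ hd pexp n amin aplus m2plus K j).regular ∧
      (actualBgFam d ℓ hd pexp n amin aplus m2plus K j).bigBlocks ∧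
      0 < (actualBgFam d ℓ hd pexp n amin aplus m2plus K j).e ∧
      (actualBgFam d ℓ hd pexp n amin aplus m2plus K j).e ≤ e₁ := by
  have hL2 : Odd (ℓ + 1) ∧ 1 < ℓ + 1 := ⟨hodd, by omega⟩
  obtain ⟨P, hPd, hPL, hPm, hPK⟩ : ∃ P : Params, P.d = d + 1 ∧ P.L = ℓ + 1 ∧ P.m = n ∧ P.K = 0 :=
    ⟨⟨d + 1, ℓ + 1, n, 0, Nat.succ_pos d, hL2⟩, rfl, rfl, rfl, rfl⟩
  obtain ⟨e, he, hle, hle1⟩ : ∃ e : ℝ, 0 < e ∧ e ≤ e₁ ∧ e ≤ 1 := ⟨min e₁ 1, by positivity, min_le_left _ _, min_le_right _ _⟩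
  obtain ⟨v, hv⟩ : ∃ v : U1Field P 1, v = fun _ => 1 := ⟨_, rfl⟩
  have hn1 : 1 ≤ (ℓ + 1) ^ 1 := Nat.one_le_pow _ _ (Nat.succ_pos ℓ)
  have h1n : 1 ≤ n := (Nat.succ_le_of_lt (Nat.mul_pos (Nat.succ_pos K) (Nat.succ_pos ℓ))).trans hKn
  refine ⟨{ k := 1, hk := le_rfl, Ω₀c := fineDom K {0}, Ωc := fineDom K {0}, hsub := Finset.Subset.refl _, a := amin, m2 := 0,
            ha1 := le_rfl, ha2 := hap, hm1 := le_rfl, hm2 := hm,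
            Ac := fun x ν => (((ℓ + 1) ^ 1 : ℕ) : ℝ) / e *
              Complex.arg ((actualBg ((Nat.succ_le_succ hd).trans_eq hPd.symm) 1 e v
                ⟨castSite (fun j : Fin P.d => x (Fin.cast hPd j)), Fin.cast hPd.symm ν⟩ : Circle) : ℂ),
            e := e, P := P, hPd := hPd, hPL := hPL, hkK := ?_, v := v, lo := fun _ => 0, hi := fun _ => (n : ℤ),
            hbox := fun κ => by rw [zero_add], hnP := ?_, hin := ?_, hlog := ?_ }, ?_, ?_, he, hle⟩
  · rw [hPm, hPK, Nat.add_zero]; exact h1n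
  · show n < 2 * P.L ^ (P.m + P.K - 0)
    rw [hPL, hPm, hPK, Nat.add_zero, Nat.sub_zero]
    calc n < 2 ^ n := Nat.lt_two_pow_self
      _ ≤ (ℓ + 1) ^ n := Nat.pow_le_pow_left (by omega) n
      _ ≤ 2 * (ℓ + 1) ^ n := Nat.le_mul_of_pos_left _ two_pos
  · intro y hy i
    rw [hPL]
    push_cast
    simp only [pow_one]
    have h0 : blk K y = 0 := by simpa [Finset.mem_singleton] using (mem_fineDom hK).mp hy
    obtain ⟨hlo, hhi⟩ := base_le_of_blk hK h0
    have hy0 : 0 ≤ y i := by simpa using hlo i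
    have hy1 : y i ≤ K := by simpa using hhi i
    have hKn' : ((K : ℤ) + 1) * ((ℓ : ℤ) + 1) ≤ n := by exact_mod_cast hKn
    have hl0 : (0 : ℤ) ≤ (ℓ : ℤ) + 1 := by positivity
    exact ⟨mul_nonneg hl0 hy0, by nlinarith [mul_le_mul_of_nonneg_left hy1 hl0]⟩
  · intro x _ ν _
    exact logField_arg hPd _ he.ne' hn1 x ν
  · show ∀ p : TPlaq P 1, ‖((plaq v p : Circle) : ℂ) - 1‖ ≤ e * (1 + Real.log e⁻¹) ^ pexp
    intro p
    have hp : plaq v p = 1 := by rw [hv]; simp [plaq]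
    rw [hp, Circle.coe_one, sub_self, norm_zero]
    have hlog0 : 0 ≤ Real.log e⁻¹ := Real.log_nonneg ((one_le_inv₀ he).mpr hle1)
    exact mul_nonneg he.le (Real.rpow_nonneg (by linarith) _)
  · exact ⟨fineDom_isBlockUnion hK _, fineDom_isBlockUnion hK _⟩

end Family

/-! ## §3  The typed Theorem of [7] on the family arising from the actual background -/

section Thm

/-- **[BalabanImbrieJaffe1985] p. 326 «THE PROPAGATORS ARISING FROM Δ_k(u_k), UNDER THE RESTRICTION (7.3.1) ON THE GAUGE FIELD, ALSO SATISFY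
THE REGULARITY AND DECAY ESTIMATES OF [7]» IN THE TYPED FORM OF [7]'s THEOREM p. 573: `ThmPrintedNN (actualBgFam …)`.**  For the block size
`K = KmodBg`: for every `0 ≤ α < 1` there are `δ₀, c₀, R₀, e₁ > 0` (`δ₀ = (4K)⁻¹`, `R₀ = K(d+4) + 2`; depending on `d, ℓ, p, n`, the windows
and `α` only) such that for EVERY instance — every torus (`P.d = d + 1`, `P.L = ℓ + 1`), every scale `1 ≤ k ≤ m + K`, every unit field `v`
WITH (7.3.1) at the coupling `0 < e ≤ e₁`, every non-wrapping box, every pair `Ω ⊆ Ω₀` of unions of `K`-blocks inside the box, every `(a, m²)`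
in the windows, every logarithm field of `u_k` on `Ω₀` — the inequalities (1.9)–(1.10) hold for `G_k(Ω, u_k)`, `D^η_{u_k,μ}G_k(Ω, u_k)` with
the transporter `U(u_k(Γ_{x,x′}))`, and (1.9)–(1.10) with the factor (1.12) hold for `δG_k(Ω, Ω₀, u_k)`, for an arbitrary source `f`, at all
`x, x′ ∈ Ω` with `dist({x,x′}, Ω^c) ≥ R₀` (resp. `dist(x, Ω^c) ≥ R₀`): `Ineq19_110 ∧ Ineq111_112`.  r01's `thmPrintedNN_regionPairFam` proof
replayed on `region_pair_members_actualBg`.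
[cite: BalabanImbrieJaffe1985, §7.3 p.326; Balaban1983RegularityDecay, Theorem (1.9)–(1.12) p.573] -/
theorem thmPrintedNN_actualBgFam {d ℓ : ℕ} (hd : 1 ≤ d) (hℓ : 1 ≤ ℓ) (hodd : Odd (ℓ + 1)) (pexp : ℝ) (n : ℕ)
    (amin aplus m2plus : ℝ) (ha : 0 < amin) :
    ThmPrintedNN (actualBgFam d ℓ hd pexp n amin aplus m2plus (KmodBg hd hℓ hodd pexp n amin aplus m2plus ha)) := by
  intro α hα0 hα1
  classical
  obtain ⟨hK16, HC⟩ := Classical.choose_spec (region_pair_members_actualBg hd hℓ hodd pexp n amin aplus m2plus ha)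
  set K : ℕ := KmodBg hd hℓ hodd pexp n amin aplus m2plus ha with hKdef
  have hKeq : Classical.choose (region_pair_members_actualBg hd hℓ hodd pexp n amin aplus m2plus ha) = K := rfl
  rw [hKeq] at hK16 HC
  have hKr : (0 : ℝ) < K := by exact_mod_cast lt_of_lt_of_le (by norm_num) hK16
  obtain ⟨C, hC, HC'⟩ := HC α hα0 hα1
  obtain ⟨e₁, he₁, H⟩ := HC' 2 (1 / 2) two_pos one_half_pos one_half_lt_one
  set N2 : ℝ := Real.sqrt (Fintype.card (Fin 2)) with hN2
  have hN2 : 0 ≤ N2 := Real.sqrt_nonneg _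
  set δ₀ : ℝ := 1 / (4 * K) with hδ₀
  have hδ₀0 : 0 < δ₀ := by positivity
  set c₀ : ℝ := N2 * C + 1 with hc₀
  have hc₀0 : 0 < c₀ := by positivity
  have hNC : N2 * C ≤ c₀ := by rw [hc₀]; linarith only
  set R₀ : ℝ := (K : ℝ) * ((d : ℝ) + 4) + 2 with hR₀
  have hR₀0 : 0 < R₀ := by positivity
  refine ⟨δ₀, c₀, R₀, e₁, hδ₀0, hc₀0, hR₀0, he₁, ?_⟩
  intro j hreg hbig he hle
  obtain ⟨i, P, hPd, hPL, hkK, v, lo, hi, hbox, hnP, hin, hlog⟩ := j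
  dsimp only [actualBgFam, regionPairFam] at hreg hbig he hle
  obtain ⟨hΩ₀, hΩ⟩ := hbig
  obtain ⟨V, Dm, Hm, dV, dD, dH⟩ := H P hPd hPL i.k i.hk hkK i.e he hle v hreg lo hi hbox hnP
    (Nat.one_le_pow i.k (ℓ + 1) (Nat.succ_pos ℓ)) i.a i.m2 i.ha1 i.ha2 i.hm1 i.hm2 i.Ω₀c i.Ωc hΩ₀ hΩ i.hsub hin i.Ac hlog
  have hn1 : 1 ≤ (ℓ + 1) ^ i.k := (Nat.one_le_pow i.k (ℓ + 1) (Nat.succ_pos ℓ))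
  have hnr : (0 : ℝ) < (((ℓ + 1) ^ i.k : ℕ) : ℝ) := by exact_mod_cast hn1
  -- the label-form `R₀` condition from `dist(x, Ω^c) ≥ R₀`
  have hRint : (0 : ℤ) ≤ (K : ℤ) * (d + 4) := by positivity
  have hlab : ∀ x : ↥(fineDom ((ℓ + 1) ^ i.k) i.Ωc), R₀ ≤ i.cdist x →
      ∀ y : Fin (d + 1) → ℤ, (∀ ν, |y ν - blk ((ℓ + 1) ^ i.k) x.1 ν| ≤ (K : ℤ) * (d + 4)) → y ∈ i.Ωc := by
    intro x hx y hy
    refine i.labels_of_cdist x hRint (le_trans (le_of_eq ?_) hx) y hy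
    rw [hR₀]; push_cast; try ring
  -- the exponential conversions (fine distances `n·D`)
  have hexp1 : ∀ {D : ℝ}, Real.exp (-((D * (((ℓ + 1) ^ i.k : ℕ) : ℝ)) / (4 * ((((ℓ + 1) ^ i.k : ℕ) : ℝ) * K)))) = Real.exp (-(δ₀ * D)) := by
    intro D
    congr 1
    rw [hδ₀]
    field_simp
  have hexp2 : ∀ D Db Df : ℝ, Real.exp (-((Db * (((ℓ + 1) ^ i.k : ℕ) : ℝ) + Df * (((ℓ + 1) ^ i.k : ℕ) : ℝ)) / (4 * ((((ℓ + 1) ^ i.k : ℕ) : ℝ) * K)))) *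
      Real.exp (-((D * (((ℓ + 1) ^ i.k : ℕ) : ℝ)) / (4 * ((((ℓ + 1) ^ i.k : ℕ) : ℝ) * K)))) = Real.exp (-(δ₀ * D)) * Real.exp (-(δ₀ * Db + δ₀ * Df)) := by
    intro D Db Df
    rw [← Real.exp_add, ← Real.exp_add]
    congr 1
    rw [hδ₀]
    field_simp
    ring
  -- sources: support, sup norm
  have hsrc : ∀ f : ↥(fineDom ((ℓ + 1) ^ i.k) i.Ωc) × Fin 2 → ℝ,
      (∀ p : ↥(fineDom ((ℓ + 1) ^ i.k) i.Ωc) × Fin 2, ¬ (p.1 ∈ i.supp f) → f p = 0) ∧ ‖f‖ ≤ supN f :=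
    fun f => ⟨fun p hp => i.eq_zero_of_not_mem_supp f p hp, RegionPairInst.norm_le_supN f⟩
  -- the support of the extension and its distances
  have hsrcE : ∀ f : ↥(fineDom ((ℓ + 1) ^ i.k) i.Ωc) × Fin 2 → ℝ, ∀ p : ↥(fineDom ((ℓ + 1) ^ i.k) i.Ω₀c) × Fin 2,
      ¬ (∃ z ∈ i.supp f, incl (Nat.one_le_pow i.k (ℓ + 1) (Nat.succ_pos ℓ)) i.hsub z = p.1) → i.extR f p = 0 := by
    rintro f ⟨p1, j⟩ hp
    by_cases hq : inReg ((ℓ + 1) ^ i.k) i.Ωc p1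
    · obtain ⟨z, hz⟩ := (B4RegionCubeCarrier.inReg_iff (Nat.one_le_pow i.k (ℓ + 1) (Nat.succ_pos ℓ)) i.hsub p1).1 hq
      have hzs : z ∉ i.supp f := fun h => hp ⟨z, h, hz⟩
      subst hz
      rw [i.extR_incl f z j]
      exact i.eq_zero_of_not_mem_supp f (z, j) hzs
    · exact i.extR_of_not_inReg f (p1, j) hq
  -- distances ↦ hypotheses of the members
  have hDs : ∀ (f : ↥(fineDom ((ℓ + 1) ^ i.k) i.Ωc) × Fin 2 → ℝ) (x : ↥(fineDom ((ℓ + 1) ^ i.k) i.Ωc)) (D : ℝ), D ≤ i.sdist1 x f →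
      ∀ x'', x'' ∈ i.supp f → ∃ μ, D * (((ℓ + 1) ^ i.k : ℕ) : ℝ) ≤ |rpos ((ℓ + 1) ^ i.k) i.Ωc x μ - rpos ((ℓ + 1) ^ i.k) i.Ωc x'' μ| :=
    fun f x D hD x'' hx'' => i.sdist1_coord x f hx'' hD
  have hDsE : ∀ (f : ↥(fineDom ((ℓ + 1) ^ i.k) i.Ωc) × Fin 2 → ℝ) (x : ↥(fineDom ((ℓ + 1) ^ i.k) i.Ωc)) (D : ℝ), D ≤ i.sdist1 x f →
      ∀ p : ↥(fineDom ((ℓ + 1) ^ i.k) i.Ω₀c), (∃ z ∈ i.supp f, incl (Nat.one_le_pow i.k (ℓ + 1) (Nat.succ_pos ℓ)) i.hsub z = p) →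
      ∃ μ, D * (((ℓ + 1) ^ i.k : ℕ) : ℝ) ≤ |rpos ((ℓ + 1) ^ i.k) i.Ω₀c (incl (Nat.one_le_pow i.k (ℓ + 1) (Nat.succ_pos ℓ)) i.hsub x) μ - rpos ((ℓ + 1) ^ i.k) i.Ω₀c p μ| := by
    intro f x D hD p hp
    obtain ⟨z, hz, rfl⟩ := hp
    exact i.sdist1_coord x f hz hD
  have hDb : ∀ (x : ↥(fineDom ((ℓ + 1) ^ i.k) i.Ωc)) (Db : ℝ), Db ≤ i.cdist x → ∀ x₁ : ↥(fineDom ((ℓ + 1) ^ i.k) i.Ω₀c),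
      ¬ inReg ((ℓ + 1) ^ i.k) i.Ωc x₁ → ∃ μ, Db * (((ℓ + 1) ^ i.k : ℕ) : ℝ) ≤ |rpos ((ℓ + 1) ^ i.k) i.Ω₀c (incl (Nat.one_le_pow i.k (ℓ + 1) (Nat.succ_pos ℓ)) i.hsub x) μ - rpos ((ℓ + 1) ^ i.k) i.Ω₀c x₁ μ| :=
    fun x Db hDb x₁ hx₁ => i.cdist_coord x hDb x₁ hx₁
  have hDf : ∀ (f : ↥(fineDom ((ℓ + 1) ^ i.k) i.Ωc) × Fin 2 → ℝ) (p : ↥(fineDom ((ℓ + 1) ^ i.k) i.Ω₀c)), (∃ z ∈ i.supp f, incl (Nat.one_le_pow i.k (ℓ + 1) (Nat.succ_pos ℓ)) i.hsub z = p) →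
      ∀ x₁ : ↥(fineDom ((ℓ + 1) ^ i.k) i.Ω₀c), ¬ inReg ((ℓ + 1) ^ i.k) i.Ωc x₁ →
      ∃ μ, i.bdistS f * (((ℓ + 1) ^ i.k : ℕ) : ℝ) ≤ |rpos ((ℓ + 1) ^ i.k) i.Ω₀c x₁ μ - rpos ((ℓ + 1) ^ i.k) i.Ω₀c p μ| := by
    intro f p hp x₁ hx₁
    obtain ⟨z, hz, rfl⟩ := hp
    obtain ⟨μ, hμ⟩ := i.cdist_coord z (i.bdistS_le f hz) x₁ hx₁
    exact ⟨μ, hμ.trans (le_of_eq (abs_sub_comm _ _))⟩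
  -- vector bounds from component bounds
  have hvec : ∀ (v : Fin 2 → ℝ) {b : ℝ}, 0 ≤ b → (∀ j, |v j| ≤ C * b) → siteNorm v ≤ c₀ * b := by
    intro v b hb hv
    refine (siteNorm_le_sqrt_card_mul v (by positivity) hv).trans ?_
    rw [← mul_assoc]
    exact mul_le_mul_of_nonneg_right hNC hb
  have hvecw : ∀ (w : ℝ) (v : Fin 2 → ℝ) {b : ℝ}, 0 ≤ w → 0 ≤ b → (∀ j, w * |v j| ≤ C * b) → w * siteNorm v ≤ c₀ * b := by
    intro w v b hw hb hv
    have : w * siteNorm v = siteNorm (w • v) := by rw [siteNorm_smul, abs_of_nonneg hw]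
    rw [this]
    refine hvec (w • v) hb fun j => ?_
    rw [Pi.smul_apply, smul_eq_mul, abs_mul, abs_of_nonneg hw]
    exact hv j
  dsimp only [Ineq19_110, Ineq111_112, actualBgFam, regionPairFam]
  refine ⟨⟨?_, ?_⟩, ⟨?_, ?_⟩⟩
  ---------------------------------------------------------------- (1.9) on `Ω`
  · intro μ f x x' hR
    rcases hR with hR | hR
    · exact hR.elim
    obtain ⟨hfP, hφ⟩ := hsrc f
    clear V Dm dV dD dH
    show i.holderQ OrthFlow.rot α μ (i.DΩ OrthFlow.rot μ *ᵥ (i.GΩ OrthFlow.rot *ᵥ f)) x x'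
      ≤ c₀ * Real.exp (-(δ₀ * min (i.sdist1 x f) (i.sdist1 x' f))) * supN f
    have hD0 : 0 ≤ min (i.sdist1 x f) (i.sdist1 x' f) := le_min (i.sdist1_nonneg x f) (i.sdist1_nonneg x' f)
    have hb0 : 0 ≤ Real.exp (-(δ₀ * min (i.sdist1 x f) (i.sdist1 x' f))) * supN f :=
      mul_nonneg (Real.exp_pos _).le (supN_nonneg f)
    refine i.holderQ_le OrthFlow.rot (mul_nonneg (mul_nonneg hc₀0.le (Real.exp_pos _).le) (supN_nonneg f)) fun l hl => ?_
    obtain ⟨hx, hx', hne, hch, hend, hlen, hnear⟩ := hl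
    have hw0 : 0 ≤ i.wt α x x' := Real.rpow_nonneg (div_nonneg hnr.le (supNorm_nonneg _)) α
    have := hvecw (i.wt α x x') _ hw0 hb0 fun j => by
      have h := Hm μ x x' hx hx' hne l hch hend hlen hnear (hlab x (hR.trans (min_le_left _ _)))
        (hlab x' (hR.trans (min_le_right _ _))) (fun z => z ∈ i.supp f)
        (min (i.sdist1 x f) (i.sdist1 x' f) * (((ℓ + 1) ^ i.k : ℕ) : ℝ)) (mul_nonneg hD0 hnr.le)
        (hDs f x _ (min_le_left _ _)) (hDs f x' _ (min_le_right _ _)) f hfP j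
      rw [hexp1] at h
      calc i.wt α x x' * |(transport (fieldLink OrthFlow.rot i.κ (acBond i.Ωc i.Ac)) x l
              *ᵥ fld (i.DΩ OrthFlow.rot μ *ᵥ (i.GΩ OrthFlow.rot *ᵥ f)) x' - fld (i.DΩ OrthFlow.rot μ *ᵥ (i.GΩ OrthFlow.rot *ᵥ f)) x) j|
          ≤ C * Real.exp (-(δ₀ * min (i.sdist1 x f) (i.sdist1 x' f))) * ‖f‖ := h
        _ ≤ C * (Real.exp (-(δ₀ * min (i.sdist1 x f) (i.sdist1 x' f))) * supN f) := by
            rw [mul_assoc]; exact mul_le_mul_of_nonneg_left (mul_le_mul_of_nonneg_left hφ (Real.exp_pos _).le) hC.le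
    calc i.wt α x x' * siteNorm (transport (fieldLink OrthFlow.rot i.κ (acBond i.Ωc i.Ac)) x l
            *ᵥ fld (i.DΩ OrthFlow.rot μ *ᵥ (i.GΩ OrthFlow.rot *ᵥ f)) x' - fld (i.DΩ OrthFlow.rot μ *ᵥ (i.GΩ OrthFlow.rot *ᵥ f)) x)
        ≤ c₀ * (Real.exp (-(δ₀ * min (i.sdist1 x f) (i.sdist1 x' f))) * supN f) := this
      _ = c₀ * Real.exp (-(δ₀ * min (i.sdist1 x f) (i.sdist1 x' f))) * supN f := by ring
  ---------------------------------------------------------------- (1.10) on `Ω`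
  · intro μ f x hR
    rcases hR with hR | hR
    · exact hR.elim
    obtain ⟨hfP, hφ⟩ := hsrc f
    clear Hm dV dD dH
    have hD0 : 0 ≤ i.sdist1 x f := i.sdist1_nonneg x f
    have hb0 : 0 ≤ Real.exp (-(δ₀ * i.sdist1 x f)) * supN f := mul_nonneg (Real.exp_pos _).le (supN_nonneg f)
    have hR0 : 0 ≤ c₀ * Real.exp (-(δ₀ * i.sdist1 x f)) * supN f :=
      mul_nonneg (mul_nonneg hc₀0.le (Real.exp_pos _).le) (supN_nonneg f)
    refine ⟨?_, ?_⟩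
    · show siteNorm (fld (i.DΩ OrthFlow.rot μ *ᵥ (i.GΩ OrthFlow.rot *ᵥ f)) x) ≤ c₀ * Real.exp (-(δ₀ * i.sdist1 x f)) * supN f
      by_cases hx : x.1 + e1 μ ∈ fineDom ((ℓ + 1) ^ i.k) i.Ωc
      · have := hvec (fld (i.DΩ OrthFlow.rot μ *ᵥ (i.GΩ OrthFlow.rot *ᵥ f)) x) hb0 fun j => by
          rw [fld_apply]
          have h := Dm μ x hx (hlab x hR) (fun z => z ∈ i.supp f) (i.sdist1 x f * (((ℓ + 1) ^ i.k : ℕ) : ℝ))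
            (mul_nonneg hD0 hnr.le) (hDs f x _ le_rfl) f hfP j
          rw [hexp1] at h
          calc |(i.DΩ OrthFlow.rot μ *ᵥ (i.GΩ OrthFlow.rot *ᵥ f)) (x, j)| ≤ C * Real.exp (-(δ₀ * i.sdist1 x f)) * ‖f‖ := h
            _ ≤ C * (Real.exp (-(δ₀ * i.sdist1 x f)) * supN f) := by
                rw [mul_assoc]; exact mul_le_mul_of_nonneg_left (mul_le_mul_of_nonneg_left hφ (Real.exp_pos _).le) hC.le
        calc siteNorm (fld (i.DΩ OrthFlow.rot μ *ᵥ (i.GΩ OrthFlow.rot *ᵥ f)) x) ≤ c₀ * (Real.exp (-(δ₀ * i.sdist1 x f)) * supN f) := this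
          _ = c₀ * Real.exp (-(δ₀ * i.sdist1 x f)) * supN f := by ring
      · rw [i.fld_DΩ_eq_zero OrthFlow.rot μ _ x hx, siteNorm_zero]
        exact hR0
    · show siteNorm (fld (i.GΩ OrthFlow.rot *ᵥ f) x) ≤ c₀ * Real.exp (-(δ₀ * i.sdist1 x f)) * supN f
      have := hvec (fld (i.GΩ OrthFlow.rot *ᵥ f) x) hb0 fun j => by
        rw [fld_apply]
        have h := V x (hlab x hR) (fun z => z ∈ i.supp f) (i.sdist1 x f * (((ℓ + 1) ^ i.k : ℕ) : ℝ))
          (mul_nonneg hD0 hnr.le) (hDs f x _ le_rfl) f hfP j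
        rw [hexp1] at h
        calc |(i.GΩ OrthFlow.rot *ᵥ f) (x, j)| ≤ C * Real.exp (-(δ₀ * i.sdist1 x f)) * ‖f‖ := h
          _ ≤ C * (Real.exp (-(δ₀ * i.sdist1 x f)) * supN f) := by
              rw [mul_assoc]; exact mul_le_mul_of_nonneg_left (mul_le_mul_of_nonneg_left hφ (Real.exp_pos _).le) hC.le
      calc siteNorm (fld (i.GΩ OrthFlow.rot *ᵥ f) x) ≤ c₀ * (Real.exp (-(δ₀ * i.sdist1 x f)) * supN f) := this
        _ = c₀ * Real.exp (-(δ₀ * i.sdist1 x f)) * supN f := by ring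
  ---------------------------------------------------------------- (1.9)·(1.12) for `δG`
  · intro μ f x x' hR
    rcases hR with hR | hR
    · exact hR.elim
    obtain ⟨hfP, hφ⟩ := hsrc f
    have hφE : ‖i.extR f‖ ≤ supN f := (i.norm_extR_le f).trans hφ
    have hres : (fun q : ↥(fineDom ((ℓ + 1) ^ i.k) i.Ωc) × Fin 2 => i.extR f (incl (Nat.one_le_pow i.k (ℓ + 1) (Nat.succ_pos ℓ)) i.hsub q.1, q.2)) = f :=
      i.resR_extR f
    clear V Dm Hm dV dD
    show i.holderQ OrthFlow.rot α μ (i.DΩ OrthFlow.rot μ *ᵥ i.deltaV OrthFlow.rot f) x x'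
      ≤ c₀ * Real.exp (-(δ₀ * min (i.sdist1 x f) (i.sdist1 x' f)))
        * Real.exp (-(δ₀ * min (i.cdist x) (i.cdist x') + δ₀ * i.bdistS f)) * supN f
    have hD0 : 0 ≤ min (i.sdist1 x f) (i.sdist1 x' f) := le_min (i.sdist1_nonneg x f) (i.sdist1_nonneg x' f)
    have hDb0 : 0 ≤ min (i.cdist x) (i.cdist x') := le_min (i.cdist_nonneg x) (i.cdist_nonneg x')
    have hDf0 : 0 ≤ i.bdistS f := i.bdistS_nonneg f
    have hb0 : 0 ≤ Real.exp (-((min (i.cdist x) (i.cdist x') * (((ℓ + 1) ^ i.k : ℕ) : ℝ) + i.bdistS f * (((ℓ + 1) ^ i.k : ℕ) : ℝ)) / (4 * ((((ℓ + 1) ^ i.k : ℕ) : ℝ) * K)))) *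
        Real.exp (-((min (i.sdist1 x f) (i.sdist1 x' f) * (((ℓ + 1) ^ i.k : ℕ) : ℝ)) / (4 * ((((ℓ + 1) ^ i.k : ℕ) : ℝ) * K)))) * supN f :=
      mul_nonneg (mul_nonneg (Real.exp_pos _).le (Real.exp_pos _).le) (supN_nonneg f)
    rw [show c₀ * Real.exp (-(δ₀ * min (i.sdist1 x f) (i.sdist1 x' f)))
          * Real.exp (-(δ₀ * min (i.cdist x) (i.cdist x') + δ₀ * i.bdistS f)) * supN f
        = c₀ * (Real.exp (-((min (i.cdist x) (i.cdist x') * (((ℓ + 1) ^ i.k : ℕ) : ℝ) + i.bdistS f * (((ℓ + 1) ^ i.k : ℕ) : ℝ)) / (4 * ((((ℓ + 1) ^ i.k : ℕ) : ℝ) * K)))) *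
        Real.exp (-((min (i.sdist1 x f) (i.sdist1 x' f) * (((ℓ + 1) ^ i.k : ℕ) : ℝ)) / (4 * ((((ℓ + 1) ^ i.k : ℕ) : ℝ) * K)))) * supN f) by
          rw [hexp2]; ring]
    refine i.holderQ_le OrthFlow.rot (mul_nonneg hc₀0.le hb0) fun l hl => ?_
    obtain ⟨hx, hx', hne, hch, hend, hlen, hnear⟩ := hl
    have hw0 : 0 ≤ i.wt α x x' := Real.rpow_nonneg (div_nonneg hnr.le (supNorm_nonneg _)) α
    refine hvecw (i.wt α x x') _ hw0 hb0 fun j => ?_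
    have h := dH μ x x' hx hx' hne l hch hend hlen hnear (hlab x (hR.trans (min_le_left _ _)))
      (hlab x' (hR.trans (min_le_right _ _))) (fun p => ∃ z ∈ i.supp f, incl (Nat.one_le_pow i.k (ℓ + 1) (Nat.succ_pos ℓ)) i.hsub z = p)
      (min (i.sdist1 x f) (i.sdist1 x' f) * (((ℓ + 1) ^ i.k : ℕ) : ℝ))
      (min (i.cdist x) (i.cdist x') * (((ℓ + 1) ^ i.k : ℕ) : ℝ)) (i.bdistS f * (((ℓ + 1) ^ i.k : ℕ) : ℝ))
      (mul_nonneg hD0 hnr.le) (mul_nonneg hDb0 hnr.le) (mul_nonneg hDf0 hnr.le)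
      (hDsE f x _ (min_le_left _ _)) (hDsE f x' _ (min_le_right _ _)) (hDb x _ (min_le_left _ _))
      (hDb x' _ (min_le_right _ _)) (hDf f) (i.extR f) (hsrcE f) j
    rw [hres] at h
    have hid : ∀ z : ↥(fineDom ((ℓ + 1) ^ i.k) i.Ωc), z.1 + e1 μ ∈ fineDom ((ℓ + 1) ^ i.k) i.Ωc →
        fld (i.DΩ OrthFlow.rot μ *ᵥ i.deltaV OrthFlow.rot f) z = fld (i.DΩ OrthFlow.rot μ *ᵥ (i.GΩ OrthFlow.rot *ᵥ f)) z
          - fld (i.D₀ OrthFlow.rot μ *ᵥ (i.G₀ OrthFlow.rot *ᵥ i.extR f)) (incl (Nat.one_le_pow i.k (ℓ + 1) (Nat.succ_pos ℓ)) i.hsub z) := by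
      intro z hz; funext j'; rw [Pi.sub_apply, i.fld_DΩ_deltaV_apply OrthFlow.rot μ f z hz j']; rfl
    rw [hid x hx, hid x' hx', Matrix.mulVec_sub]
    have halg : transport (fieldLink OrthFlow.rot i.κ (acBond i.Ωc i.Ac)) x l *ᵥ fld (i.DΩ OrthFlow.rot μ *ᵥ (i.GΩ OrthFlow.rot *ᵥ f)) x'
          - transport (fieldLink OrthFlow.rot i.κ (acBond i.Ωc i.Ac)) x l *ᵥ fld (i.D₀ OrthFlow.rot μ *ᵥ (i.G₀ OrthFlow.rot *ᵥ i.extR f))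
              (incl (Nat.one_le_pow i.k (ℓ + 1) (Nat.succ_pos ℓ)) i.hsub x')
          - (fld (i.DΩ OrthFlow.rot μ *ᵥ (i.GΩ OrthFlow.rot *ᵥ f)) x - fld (i.D₀ OrthFlow.rot μ *ᵥ (i.G₀ OrthFlow.rot *ᵥ i.extR f)) (incl (Nat.one_le_pow i.k (ℓ + 1) (Nat.succ_pos ℓ)) i.hsub x))
        = transport (fieldLink OrthFlow.rot i.κ (acBond i.Ωc i.Ac)) x l *ᵥ fld (i.DΩ OrthFlow.rot μ *ᵥ (i.GΩ OrthFlow.rot *ᵥ f)) x'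
          - fld (i.DΩ OrthFlow.rot μ *ᵥ (i.GΩ OrthFlow.rot *ᵥ f)) x
          - (transport (fieldLink OrthFlow.rot i.κ (acBond i.Ωc i.Ac)) x l *ᵥ fld (i.D₀ OrthFlow.rot μ *ᵥ (i.G₀ OrthFlow.rot *ᵥ i.extR f))
              (incl (Nat.one_le_pow i.k (ℓ + 1) (Nat.succ_pos ℓ)) i.hsub x') - fld (i.D₀ OrthFlow.rot μ *ᵥ (i.G₀ OrthFlow.rot *ᵥ i.extR f)) (incl (Nat.one_le_pow i.k (ℓ + 1) (Nat.succ_pos ℓ)) i.hsub x)) := by abel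
    rw [halg]
    refine h.trans ?_
    rw [mul_assoc C, mul_assoc C]
    exact mul_le_mul_of_nonneg_left (mul_le_mul_of_nonneg_left hφE (by positivity)) hC.le
  ---------------------------------------------------------------- (1.10)·(1.12) for `δG`
  · intro μ f x hR
    rcases hR with hR | hR
    · exact hR.elim
    obtain ⟨hfP, hφ⟩ := hsrc f
    have hφE : ‖i.extR f‖ ≤ supN f := (i.norm_extR_le f).trans hφ
    have hres : (fun q : ↥(fineDom ((ℓ + 1) ^ i.k) i.Ωc) × Fin 2 => i.extR f (incl (Nat.one_le_pow i.k (ℓ + 1) (Nat.succ_pos ℓ)) i.hsub q.1, q.2)) = f :=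
      i.resR_extR f
    clear V Dm Hm dH
    have hD0 : 0 ≤ i.sdist1 x f := i.sdist1_nonneg x f
    have hDb0 : 0 ≤ i.cdist x := i.cdist_nonneg x
    have hDf0 : 0 ≤ i.bdistS f := i.bdistS_nonneg f
    have hb0 : 0 ≤ Real.exp (-((i.cdist x * (((ℓ + 1) ^ i.k : ℕ) : ℝ) + i.bdistS f * (((ℓ + 1) ^ i.k : ℕ) : ℝ)) / (4 * ((((ℓ + 1) ^ i.k : ℕ) : ℝ) * K)))) *
        Real.exp (-((i.sdist1 x f * (((ℓ + 1) ^ i.k : ℕ) : ℝ)) / (4 * ((((ℓ + 1) ^ i.k : ℕ) : ℝ) * K)))) * supN f :=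
      mul_nonneg (mul_nonneg (Real.exp_pos _).le (Real.exp_pos _).le) (supN_nonneg f)
    have hRHS : c₀ * Real.exp (-(δ₀ * i.sdist1 x f)) * Real.exp (-(δ₀ * i.cdist x + δ₀ * i.bdistS f)) * supN f
        = c₀ * (Real.exp (-((i.cdist x * (((ℓ + 1) ^ i.k : ℕ) : ℝ) + i.bdistS f * (((ℓ + 1) ^ i.k : ℕ) : ℝ)) / (4 * ((((ℓ + 1) ^ i.k : ℕ) : ℝ) * K)))) *
          Real.exp (-((i.sdist1 x f * (((ℓ + 1) ^ i.k : ℕ) : ℝ)) / (4 * ((((ℓ + 1) ^ i.k : ℕ) : ℝ) * K)))) * supN f) := by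
      rw [hexp2]; ring
    have hfin : ∀ {t : ℝ}, t ≤ C * Real.exp (-((i.cdist x * (((ℓ + 1) ^ i.k : ℕ) : ℝ) + i.bdistS f * (((ℓ + 1) ^ i.k : ℕ) : ℝ)) / (4 * ((((ℓ + 1) ^ i.k : ℕ) : ℝ) * K)))) *
        Real.exp (-((i.sdist1 x f * (((ℓ + 1) ^ i.k : ℕ) : ℝ)) / (4 * ((((ℓ + 1) ^ i.k : ℕ) : ℝ) * K)))) * ‖i.extR f‖ →
        t ≤ C * (Real.exp (-((i.cdist x * (((ℓ + 1) ^ i.k : ℕ) : ℝ) + i.bdistS f * (((ℓ + 1) ^ i.k : ℕ) : ℝ)) / (4 * ((((ℓ + 1) ^ i.k : ℕ) : ℝ) * K)))) *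
        Real.exp (-((i.sdist1 x f * (((ℓ + 1) ^ i.k : ℕ) : ℝ)) / (4 * ((((ℓ + 1) ^ i.k : ℕ) : ℝ) * K)))) * supN f) := by
      intro t ht
      refine ht.trans ?_
      rw [mul_assoc C, mul_assoc C]
      exact mul_le_mul_of_nonneg_left (mul_le_mul_of_nonneg_left hφE (by positivity)) hC.le
    refine ⟨?_, ?_⟩
    · show siteNorm (fld (i.DΩ OrthFlow.rot μ *ᵥ i.deltaV OrthFlow.rot f) x)
        ≤ c₀ * Real.exp (-(δ₀ * i.sdist1 x f)) * Real.exp (-(δ₀ * i.cdist x + δ₀ * i.bdistS f)) * supN f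
      rw [hRHS]
      by_cases hx : x.1 + e1 μ ∈ fineDom ((ℓ + 1) ^ i.k) i.Ωc
      · refine hvec _ hb0 fun j => ?_
        have h := dD μ x hx (hlab x hR) (fun p => ∃ z ∈ i.supp f, incl (Nat.one_le_pow i.k (ℓ + 1) (Nat.succ_pos ℓ)) i.hsub z = p)
          (i.sdist1 x f * (((ℓ + 1) ^ i.k : ℕ) : ℝ)) (i.cdist x * (((ℓ + 1) ^ i.k : ℕ) : ℝ))
          (i.bdistS f * (((ℓ + 1) ^ i.k : ℕ) : ℝ)) (mul_nonneg hD0 hnr.le) (mul_nonneg hDb0 hnr.le)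
          (mul_nonneg hDf0 hnr.le) (hDsE f x _ le_rfl) (hDb x _ le_rfl) (hDf f)
          (i.extR f) (hsrcE f) j
        rw [hres] at h
        rw [i.fld_DΩ_deltaV_apply OrthFlow.rot μ f x hx j]
        exact hfin h
      · rw [i.fld_DΩ_eq_zero OrthFlow.rot μ _ x hx, siteNorm_zero]
        exact mul_nonneg hc₀0.le hb0
    · show siteNorm (fld (i.deltaV OrthFlow.rot f) x)
        ≤ c₀ * Real.exp (-(δ₀ * i.sdist1 x f)) * Real.exp (-(δ₀ * i.cdist x + δ₀ * i.bdistS f)) * supN f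
      rw [hRHS]
      refine hvec _ hb0 fun j => ?_
      have h := dV x (hlab x hR) (fun p => ∃ z ∈ i.supp f, incl (Nat.one_le_pow i.k (ℓ + 1) (Nat.succ_pos ℓ)) i.hsub z = p)
        (i.sdist1 x f * (((ℓ + 1) ^ i.k : ℕ) : ℝ)) (i.cdist x * (((ℓ + 1) ^ i.k : ℕ) : ℝ))
        (i.bdistS f * (((ℓ + 1) ^ i.k : ℕ) : ℝ)) (mul_nonneg hD0 hnr.le) (mul_nonneg hDb0 hnr.le)
        (mul_nonneg hDf0 hnr.le) (hDsE f x _ le_rfl) (hDb x _ le_rfl) (hDf f)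
        (i.extR f) (hsrcE f) j
      rw [hres] at h
      rw [i.fld_deltaV_apply OrthFlow.rot f x j]
      exact hfin h

end Thm

/-! ## §4  (1.8) on the same family -/

section Claim18

variable {X ι : Type*}

/-- forms under block-diagonal conjugation: `⟨Φ, 𝒢H𝒢ᵀΦ⟩ = ⟨𝒢ᵀΦ, H𝒢ᵀΦ⟩`. [cite: Balaban1983RegularityDecay, (1.8) p.573, p.580 «we reduce them to the case A₀ = 0»] -/
theorem dotProduct_conj_mulVec [Fintype X] [Fintype ι] [DecidableEq X] (g : X → Matrix ι ι ℝ)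
    (H : Matrix (X × ι) (X × ι) ℝ) (Φ : X × ι → ℝ) :
    Φ ⬝ᵥ ((blockDiag g * H * (blockDiag g)ᵀ) *ᵥ Φ) = ((blockDiag g)ᵀ *ᵥ Φ) ⬝ᵥ (H *ᵥ ((blockDiag g)ᵀ *ᵥ Φ)) := by
  rw [← Matrix.mulVec_mulVec, ← Matrix.mulVec_mulVec, Matrix.dotProduct_mulVec, Matrix.mulVec_transpose]

/-- **(1.8) ON THE FAMILY ARISING FROM THE ACTUAL BACKGROUND** («−Δ^{η,N}_{A,Ω} + aP_k(A) ≥ γ₀I … γ₀ independent of η, Ω and A», for the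
operators arising from `Δ_k(u_k)` under (7.3.1)): for every block size `K`, `Claim18Printed (actualBgFam … K)` — there are `γ₀, e₁ > 0`
(`γ₀ = min(2, ¾a₋)/4`, as r01's `claim18Printed_regionPairFam`) such that at every instance with (7.3.1) and `0 < e ≤ e₁`:
`γ₀‖w‖² ≤ ⟨w, (−Δ^{η,N}_{u_k,Ω} + m² + a_kP_k(u_k))w⟩` on `Ω`, the operator built from `u_k`'s bond variables (any logarithm field).  r01's
`B4Lower18RegularRegion.lower18_regular_region_printed` at the running coefficient `a_k ∈ [¾a₋, a₊]` for the smooth gauge, conjugated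
(forms are invariant under the sitewise orthogonal gauge). [cite: BalabanImbrieJaffe1985, §7.3 p.326; Balaban1983RegularityDecay, (1.8) p.573] -/
theorem claim18Printed_actualBgFam {d ℓ : ℕ} (hd : 1 ≤ d) (hℓ : 1 ≤ ℓ) (hodd : Odd (ℓ + 1)) (pexp : ℝ) (n : ℕ)
    (amin aplus m2plus : ℝ) (ha : 0 < amin) (K : ℕ) :
    Claim18Printed (actualBgFam d ℓ hd pexp n amin aplus m2plus K) := by
  obtain ⟨e₁, he₁, h₁⟩ := B4CubeFieldHyps22.cubeField_threshold d (c := 0) (aplus := aplus) (creg := 2) (β := 1 / 2)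
    zero_le_one le_rfl ha zero_le_two one_half_pos 1 K
  obtain ⟨e₂, he₂, hall⟩ := exists_smooth_gauge_links hd hℓ hodd pexp n (β := 1 / 2) (c := 2) one_half_lt_one two_pos
  refine ⟨min 2 (3 / 4 * amin) / 4, min e₁ e₂, by positivity, lt_min he₁ he₂, ?_⟩
  intro j hreg he hle w
  obtain ⟨i, P, hPd, hPL, hkK, v, lo, hi, hbox, hnP, hin, hlog⟩ := j
  dsimp only [actualBgFam, regionPairFam] at hreg he hle ⊢
  have hn : 1 ≤ (ℓ + 1) ^ i.k := Nat.one_le_pow i.k (ℓ + 1) (Nat.succ_pos ℓ)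
  -- the smooth gauge on `Ω₀` and the link relation for the logarithm field `A_c`
  obtain ⟨lam, A, hregA, hlinks⟩ := hall P hPd hPL i.k i.hk hkK i.e he (hle.trans (min_le_right _ _)) v hreg lo hi hbox hnP i.Ω₀c hin
  have hlinkA := hlinks i.Ac hlog
  obtain ⟨Ah, hAh_def⟩ : ∃ Ah : (Fin (d + 1) → ℤ) → Fin (d + 1) → ℝ,
      Ah = fun x ν => A ⟨castSite (fun j : Fin P.d => x (Fin.cast hPd j)), Fin.cast hPd.symm ν⟩ := ⟨_, rfl⟩
  obtain ⟨sg, hsg_def⟩ : ∃ sg : (Fin (d + 1) → ℤ) → ℝ,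
      sg = fun x => -((((ℓ + 1) ^ i.k : ℕ) : ℝ) * lam (castSite (fun j : Fin P.d => x (Fin.cast hPd j)))) := ⟨_, rfl⟩
  have hregh : ∀ x ∈ fineDom ((ℓ + 1) ^ i.k) i.Ω₀c, ∀ μ ν : Fin (d + 1),
      |Ah (x + e1 μ) ν - Ah x ν| ≤ 2 * i.e ^ ((1 : ℝ) / 2 - 1) / (((ℓ + 1) ^ i.k : ℕ) : ℝ) := by
    rw [hAh_def]; exact hregA
  have hmono : fineDom ((ℓ + 1) ^ i.k) i.Ωc ⊆ fineDom ((ℓ + 1) ^ i.k) i.Ω₀c := fun z hz =>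
    (mem_fineDom hn).mpr (i.hsub ((mem_fineDom hn).mp hz))
  have hlink : ∀ x ∈ fineDom ((ℓ + 1) ^ i.k) i.Ωc, ∀ ν : Fin (d + 1), x + e1 ν ∈ fineDom ((ℓ + 1) ^ i.k) i.Ωc →
      OrthFlow.rot.U (i.e / (((ℓ + 1) ^ i.k : ℕ) : ℝ) * i.Ac x ν)
        = OrthFlow.rot.U (i.e / (((ℓ + 1) ^ i.k : ℕ) : ℝ) * (Ah x ν + sg x - sg (x + e1 ν))) := by
    rw [hAh_def, hsg_def]; exact fun x hx ν hν => hlinkA x (hmono hx) ν (hmono hν)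
  obtain ⟨g, hg_def⟩ : ∃ g : ↥(fineDom ((ℓ + 1) ^ i.k) i.Ωc) → Matrix (Fin 2) (Fin 2) ℝ,
      g = fun u => OrthFlow.rot.U (i.e / (((ℓ + 1) ^ i.k : ℕ) : ℝ) * sg u.1) := ⟨_, rfl⟩
  have hg : IsGauge g := by rw [hg_def]; exact OrthFlow.rot.isGauge _
  have hop : regionOp OrthFlow.rot i.e hn (B1.aSeq i.a ((ℓ : ℝ) + 1) i.k) i.m2 i.Ωc i.Ac
      = blockDiag g * regionOp OrthFlow.rot i.e hn (B1.aSeq i.a ((ℓ : ℝ) + 1) i.k) i.m2 i.Ωc Ah * (blockDiag g)ᵀ := by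
    rw [hg_def]
    exact regionOp_gauge OrthFlow.rot i.e hn (B1.aSeq i.a ((ℓ : ℝ) + 1) i.k) i.m2 i.Ωc (Ac := Ah) (σ := sg) hlink
  -- r01's (1.8) at the smooth gauge, at the running coefficient
  obtain ⟨hak1, hak2⟩ := B4CubeFieldHyps22.aSeq_window hℓ i.hk ha i.ha1 i.ha2
  obtain ⟨_, hsm, _⟩ := h₁ i.e he (hle.trans (min_le_left _ _)) _ hak1 hak2
  have hsmall : (1 : ℝ) ^ 2 * (((d : ℝ) + 1) * 2 * i.e ^ ((1 : ℝ) / 2)) ^ 2 * ((d : ℝ) + 1)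
      * (1 + B1.aSeq i.a ((ℓ : ℝ) + 1) i.k * ((d : ℝ) + 1)) ≤ min 2 (B1.aSeq i.a ((ℓ : ℝ) + 1) i.k) / 4 := by
    simpa only [Nat.cast_one, mul_one] using hsm
  have hak0 : 0 ≤ B1.aSeq i.a ((ℓ : ℝ) + 1) i.k := le_trans (by positivity) hak1
  have h17Ω : ∀ x ∈ fineDom ((ℓ + 1) ^ i.k) i.Ωc, ∀ μ ν : Fin (d + 1),
      |Ah (x + e1 μ) ν - Ah x ν| ≤ 2 * i.e ^ ((1 : ℝ) / 2 - 1) / ((ℓ + 1) ^ i.k : ℕ) :=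
    fun x hx μ ν => hregh x (hmono hx) μ ν
  have h := B4Lower18RegularRegion.lower18_regular_region_printed OrthFlow.rot zero_le_one rot_lipschitz he hn hak0 i.m2 i.Ωc
    zero_le_two h17Ω hsmall ((blockDiag g)ᵀ *ᵥ w)
  have hγ : min 2 (3 / 4 * amin) / 4 ≤ min 2 (B1.aSeq i.a ((ℓ : ℝ) + 1) i.k) / 4 + i.m2 := by
    have : min 2 (3 / 4 * amin) ≤ min 2 (B1.aSeq i.a ((ℓ : ℝ) + 1) i.k) := min_le_min le_rfl hak1
    linarith [i.hm1]
  rw [hop, dotProduct_conj_mulVec, ← gauge_transpose_dotProduct_self hg w]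
  exact (mul_le_mul_of_nonneg_right hγ (dotProduct_self_nonneg' _)).trans h

end Claim18

end

end Literature.MathematicalPhysics.QuantumFieldTheory.BalabanImbrieJaffe1984to88.BIJ85RegionPropagatorsActualBgThm
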